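import Literature.Barriers.HubbardSuperconductivity.SignProblemNPHardGadget
import Literature.Computability.Complexity.HashBricks
import HarnessLib

/-!
# Polynomial-time machines for the CNF ↦ Ising reduction: tokenizer, matrix emitter, query, threshold test

Support file for the discharge of the barrier `SignProblemNPHard` (Troyer–Wiese 2005,
`SignProblemNPHard.lean`; assembled in `SignProblemNPHardProofs.lean`). The combinatorial gadget
`CNFIsing.J`, `CNFIsing.threshold` of `SignProblemNPHardGadget.lean` sends a token list `T` (the
literal occurrences of a CNF) to a unit-coupling Ising instance on `2L + 1` spins. Here we build,
in the tree's algebra of `FP` string functions (`comp_mem_FP`, `fanoutFn`, `iteFn` on one-bit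
conditions, records `Brick.nthF`/`sndPow`, clocked loops `iterate_mem_FP` /
`iterate_mem_FP_of_growth`, the leaves `eqPairFn`, `headBitFn`, `popCountFn`, `umulFn`,
`addFn`, `ltFn`, `concatFn`), the two string functions of the one-query oracle algorithm of
Troyer–Wiese's reduction [cite: TroyerWiese2005, Letter p. 4] — no machine is written by hand:

* **The tokenizer** `tokFn` (`tokFn_mem_FP`): `|z|` rounds of `tokStepB` on a state record
  (`TokSt.enc`), reading the `encodingCNF` structure of `z` with the total pair decoder
  (`fstF`/`sndF`): clause by clause (unary clause-count header), literal by literal (unary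
  literal-count header), emitting one token record `⟨num, ⟨[pol], [first]⟩⟩` (`tokRec`) per
  literal, and counting tokens (`1^L`) and clauses (`1^m`). Its mathematical mirror is the state
  machine `TokSt.step` (`tokStepB_enc`, `tokFn_apply`); **`toks z`** is the token list read off an
  arbitrary string `z` (`length_toks_le`: at most `|z|` tokens), and on the code of a CNF `φ` it is
  the token list of `φ` with variables renamed into binary numerals (`toks_encode`,
  `clauseCount_encode`).
* **The matrix emitter** `itemsB` (`itemsB_mem_FP`, `itemsB_apply`): a row loop (`rowStepB`,
  `rowFnB`, model `rowM`) nested in a matrix loop (`matStepB`, `matFnB`, model `matM`),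
  parameterised by column emitters; with the emitters `emitR`/`emitC`/`emitY` (one framed
  `encodingIntBool` item `chunk v` per entry, computed from the two token records, the unary row
  and column positions and the clause flags by the one-bit tests `numEqT`, `polEqT`, `qEqPT`,
  `qEqSuccPT`, `colFirstT`) its output is the body of the row-major coded entry list of
  `J (toks z)` (`itemsM_eq`, through `matrixEntries_eq`, `rowStr_zero`/`rowStr_copy`/`rowStr_aux`
  and the entity lemmas `J_zero_aux`, `J_copy_copy`, `J_copy_aux`, `J_aux_aux`, …); with the
  emitter `emitCnt` it is `1^{2P+L}` (`countStr_eq_ones`, `orderedPairCount_eq`).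
* **The query** `qryFn` (`qryFn_mem_FP`, `qryFn_apply`):
  `qryFn z = thermalQuery ⟨n, J (toks z)⟩ (3n + 3) 3`, `n = 2L + 1` — the matrix code
  `⟨encodeNat n, ⟨1^{n²}, items⟩⟩` (`matrixCodeB_tokFn`), inverse temperature `3n + 3` and accuracy
  parameter `3` (i.e. `1/4`) in unary.
* **The decision** `decFn` (`decFn_mem_FP`, `decFn_boolPair`): on `⟨z, code a⟩`, `a : ℤ` the
  oracle's answer, the bit `[a < 3 - 4 N(z)]` with `N(z) = P + L + m` (`thresholdN`; so that
  `-N(z)` is the gadget threshold), computed as `4N < |a| + 3` / `4N + a < 3` on binary numerals,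
  `4N` being obtained in unary as `1^{2P+L} 1^{2P+L} 1^L 1^L (1^m)⁴` and converted by `popCountFn`.

Every length bound needed by the loop combinators is proved on *all* strings (`length_fields4_le`
etc.: the fields of a record fit in it), so the functions are total and in `FP` without any
well-formedness hypothesis; the semantic lemmas are stated on the records the algorithm actually
produces.

## References

* M. Troyer, U.-J. Wiese, PRL 94 (2005) 170201, Letter p. 4 (the reduction: one thermal average of
  the spin glass at `β ≥ N ln 2 + ln 12N` decides the ground-state question).
* S. Arora, B. Barak, *Computational Complexity: A Modern Approach*, CUP 2009, §1.3 (polynomial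
  time is closed under composition and polynomially bounded loops), §0.1 (codes).
-/

namespace Literature.Barriers.HubbardSuperconductivity

open _root_.Computability Literature.Computability.Complexity Brick HashBricks OracleCompose PRelSigma
  Polynomial
open SProg (dbl dbl_mem_FP length_dbl)

namespace CNFIsing

/-! ### Token records -/

/-- String tokens: tokens whose variable names are bit strings (binary numerals as read off a
CNF code). [folklore] -/
abbrev STok : Type := Token (List Bool)

/-- The record `⟨num, ⟨[pol], [first]⟩⟩` of a string token. [folklore] -/
def tokRec (t : STok) : List Bool :=
  boolPair t.var (boolPair [t.pol] [t.first])

/-- The first field of a record: the variable name. [folklore] -/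
@[simp] theorem fstF_tokRec (t : STok) : fstF (tokRec t) = t.var := by simp [tokRec]

/-- The rest of a record: polarity and clause flag. [folklore] -/
@[simp] theorem sndF_tokRec (t : STok) : sndF (tokRec t) = boolPair [t.pol] [t.first] := by simp [tokRec]

/-- The second field of a record: the polarity bit. [folklore] -/
@[simp] theorem nthF_one_tokRec (t : STok) : nthF 1 (tokRec t) = [t.pol] := by simp [tokRec]

/-- The last field of a record: the clause flag. [folklore] -/
@[simp] theorem sndPow_one_tokRec (t : STok) : sndPow 1 (tokRec t) = [t.first] := by simp [tokRec]

/-- Length of a record. [folklore] -/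
theorem length_tokRec (t : STok) : (tokRec t).length = 2 * t.var.length + 7 := by
  simp [tokRec]

/-- Coded lists are concatenations of framed items. [folklore] -/
theorem body_eq_flatMap (l : List (List Bool)) : body l = l.flatMap fun a => dbl a ++ [false, true] := by
  induction l with
  | nil => rfl
  | cons a l ih => rw [body_cons, List.flatMap_cons, ← ih, boolPair]; simp [dbl, List.append_assoc]

/-- Appending an item to a coded list appends its frame. [folklore] -/
theorem body_append_singleton (l : List (List Bool)) (a : List Bool) :
    body (l ++ [a]) = body l ++ (dbl a ++ [false, true]) := by
  simp [body_eq_flatMap]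

/-! ### The tokenizer: its mathematical model -/

/-- The state of the tokenizer: the rest of the clause-count header, the rest of the clause list,
the rest of the current literal-count header, the rest of the current literal list, the
"next literal opens a clause" flag, the number of tokens, the number of clauses, the tokens.
[folklore] -/
structure TokSt where
  /-- rest of the unary clause-count header -/
  hdr : List Bool
  /-- rest of the coded clause list -/
  bdy : List Bool
  /-- rest of the unary literal-count header of the current clause -/
  khdr : List Bool
  /-- rest of the coded literal list of the current clause -/
  lbody : List Bool
  /-- whether the next literal opens a clause -/
  flag : Bool
  /-- number of tokens emitted -/
  ell : ℕ
  /-- number of clauses opened -/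
  mc : ℕ
  /-- the tokens emitted -/
  toks : List STok

namespace TokSt

/-- The record of a tokenizer state after the ruler `x`:
`⟨x, ⟨hdr, ⟨bdy, ⟨khdr, ⟨lbody, ⟨[flag], ⟨1^ell, ⟨1^mc, body (records)⟩⟩⟩⟩⟩⟩⟩⟩`. [folklore] -/
def enc (x : List Bool) (s : TokSt) : List Bool :=
  boolPair x (boolPair s.hdr (boolPair s.bdy (boolPair s.khdr (boolPair s.lbody (boolPair [s.flag]
    (boolPair (ones s.ell) (boolPair (ones s.mc) (body (s.toks.map tokRec)))))))))

/-- A literal step: read one literal of the current clause and emit its token. [folklore] -/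
def litStep (s : TokSt) : TokSt :=
  { s with
    khdr := s.khdr.tail, lbody := sndF s.lbody, flag := false, ell := s.ell + 1
    toks := s.toks ++ [⟨fstF (fstF s.lbody), (sndF (fstF s.lbody)).headD false, s.flag⟩] }

/-- A clause step: open the next clause. [folklore] -/
def clauseStep (s : TokSt) : TokSt :=
  { s with
    hdr := s.hdr.tail, bdy := sndF s.bdy, khdr := fstF (fstF s.bdy), lbody := sndF (fstF s.bdy)
    flag := true, mc := s.mc + 1 }

/-- One round of the tokenizer: a literal step while the current clause has literals left, else a
clause step while clauses are left, else nothing. [folklore] -/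
def step (s : TokSt) : TokSt :=
  if s.khdr = [] then (if s.hdr = [] then s else s.clauseStep) else s.litStep

/-- The initial state on input `z = ⟨header, clause list⟩`. [folklore] -/
def init (z : List Bool) : TokSt :=
  ⟨fstF z, sndF z, [], [], false, 0, 0, []⟩

/-- The token counter counts the tokens. [folklore] -/
theorem ell_iterate_step (s : TokSt) (h : s.ell = s.toks.length) (n : ℕ) :
    (step^[n] s).ell = (step^[n] s).toks.length := by
  induction n generalizing s with
  | zero => exact h
  | succ n ih =>
    rw [Function.iterate_succ_apply]
    apply ih
    unfold step
    split_ifs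
    · exact h
    · exact h
    · simp [litStep, h]

/-- At most one token per round. [folklore] -/
theorem length_toks_iterate_step_le (s : TokSt) (n : ℕ) :
    (step^[n] s).toks.length ≤ s.toks.length + n := by
  induction n generalizing s with
  | zero => simp
  | succ n ih =>
    rw [Function.iterate_succ_apply]
    refine (ih _).trans ?_
    unfold step
    split_ifs <;> simp [clauseStep, litStep]
    omega

/-- The clause counter grows by at most one per round. [folklore] -/
theorem mc_iterate_step_le (s : TokSt) (n : ℕ) : (step^[n] s).mc ≤ s.mc + n := by
  induction n generalizing s with
  | zero => simp
  | succ n ih =>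
    rw [Function.iterate_succ_apply]
    refine (ih _).trans ?_
    unfold step
    split_ifs <;> simp [clauseStep, litStep]
    omega

end TokSt

/-- **The tokenizer's final state on input `z`**: `|z|` rounds from the initial state. [folklore] -/
def tokState (z : List Bool) : TokSt :=
  TokSt.step^[z.length] (TokSt.init z)

/-- **The string tokens read off an arbitrary input `z`.** [folklore] -/
def toks (z : List Bool) : List STok :=
  (tokState z).toks

/-- The number of clauses read off `z`. [folklore] -/
def clauseCount (z : List Bool) : ℕ :=
  (tokState z).mc

/-- The token counter of the final state is the number of tokens. [folklore] -/
theorem ell_tokState (z : List Bool) : (tokState z).ell = (toks z).length :=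
  TokSt.ell_iterate_step _ rfl _

/-- There are at most `|z|` tokens. [folklore] -/
theorem length_toks_le (z : List Bool) : (toks z).length ≤ z.length := by
  have := TokSt.length_toks_iterate_step_le (TokSt.init z) z.length
  simpa [toks, tokState, TokSt.init] using this

/-- There are at most `|z|` clauses. [folklore] -/
theorem clauseCount_le (z : List Bool) : clauseCount z ≤ z.length := by
  have := TokSt.mc_iterate_step_le (TokSt.init z) z.length
  simpa [clauseCount, tokState, TokSt.init] using this

/-! ### The tokenizer: its bricks -/

/-- The record of the token read in a literal step, from the state record. [folklore] -/
noncomputable def tokOfB : List Bool → List Bool :=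
  fanoutFn (fstF ∘ fstF ∘ nthF 4) (fanoutFn (headBitFn ∘ sndF ∘ fstF ∘ nthF 4) (nthF 5))

/-- The new token field of a literal step: the old coded token list with the new record appended.
[folklore] -/
noncomputable def accB : List Bool → List Bool :=
  concatFn ∘ fanoutFn (sndPow 7) (concatFn ∘ fanoutFn (dbl ∘ tokOfB) fun _ => [false, true])

/-- The last four fields after a literal step. [folklore] -/
noncomputable def litTailB : List Bool → List Bool :=
  fanoutFn (fun _ => [false]) (fanoutFn (List.cons true ∘ nthF 6) (fanoutFn (nthF 7) accB))

/-- The literal step on state records. [folklore] -/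
noncomputable def litB : List Bool → List Bool :=
  fanoutFn (nthF 0) (fanoutFn (nthF 1) (fanoutFn (nthF 2) (fanoutFn (List.tail ∘ nthF 3)
    (fanoutFn (sndF ∘ nthF 4) litTailB))))

/-- The last four fields after a clause step. [folklore] -/
noncomputable def clauseTailB : List Bool → List Bool :=
  fanoutFn (fun _ => [true]) (fanoutFn (nthF 6) (fanoutFn (List.cons true ∘ nthF 7) (sndPow 7)))

/-- The clause step on state records. [folklore] -/
noncomputable def clauseB : List Bool → List Bool :=
  fanoutFn (nthF 0) (fanoutFn (List.tail ∘ nthF 1) (fanoutFn (sndF ∘ nthF 2)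
    (fanoutFn (fstF ∘ fstF ∘ nthF 2) (fanoutFn (sndF ∘ fstF ∘ nthF 2) clauseTailB))))

/-- **One round of the tokenizer on state records.** [folklore] -/
noncomputable def tokStepB : List Bool → List Bool :=
  iteFn (isNilFn ∘ nthF 3) (iteFn (isNilFn ∘ nthF 1) id clauseB) litB

/-- `tokOfB ∈ FP`. [folklore] -/
theorem tokOfB_mem_FP : tokOfB ∈ FP :=
  fanoutFn_mem_FP (comp_mem_FP fstF_mem_FP (comp_mem_FP fstF_mem_FP (nthF_mem_FP 4)))
    (fanoutFn_mem_FP (comp_mem_FP headBitFn_mem_FP (comp_mem_FP sndF_mem_FP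
      (comp_mem_FP fstF_mem_FP (nthF_mem_FP 4)))) (nthF_mem_FP 5))

/-- `accB ∈ FP`. [folklore] -/
theorem accB_mem_FP : accB ∈ FP :=
  comp_mem_FP concatFn_mem_FP (fanoutFn_mem_FP (sndPow_mem_FP 7)
    (comp_mem_FP concatFn_mem_FP (fanoutFn_mem_FP (comp_mem_FP dbl_mem_FP tokOfB_mem_FP) (const_mem_FP _))))

/-- Value of `accB`. [folklore] -/
@[simp] theorem accB_apply (w : List Bool) : accB w = sndPow 7 w ++ (dbl (tokOfB w) ++ [false, true]) := by
  simp [accB]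

/-- `litTailB ∈ FP`. [folklore] -/
theorem litTailB_mem_FP : litTailB ∈ FP :=
  fanoutFn_mem_FP (const_mem_FP _) (fanoutFn_mem_FP (comp_mem_FP (cons_mem_FP true) (nthF_mem_FP 6))
    (fanoutFn_mem_FP (nthF_mem_FP 7) accB_mem_FP))

/-- `litB ∈ FP`. [folklore] -/
theorem litB_mem_FP : litB ∈ FP :=
  fanoutFn_mem_FP (nthF_mem_FP 0) (fanoutFn_mem_FP (nthF_mem_FP 1) (fanoutFn_mem_FP (nthF_mem_FP 2)
    (fanoutFn_mem_FP (comp_mem_FP tail_mem_FP (nthF_mem_FP 3))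
      (fanoutFn_mem_FP (comp_mem_FP sndF_mem_FP (nthF_mem_FP 4)) litTailB_mem_FP))))

/-- `clauseTailB ∈ FP`. [folklore] -/
theorem clauseTailB_mem_FP : clauseTailB ∈ FP :=
  fanoutFn_mem_FP (const_mem_FP _) (fanoutFn_mem_FP (nthF_mem_FP 6)
    (fanoutFn_mem_FP (comp_mem_FP (cons_mem_FP true) (nthF_mem_FP 7)) (sndPow_mem_FP 7)))

/-- `clauseB ∈ FP`. [folklore] -/
theorem clauseB_mem_FP : clauseB ∈ FP :=
  fanoutFn_mem_FP (nthF_mem_FP 0) (fanoutFn_mem_FP (comp_mem_FP tail_mem_FP (nthF_mem_FP 1))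
    (fanoutFn_mem_FP (comp_mem_FP sndF_mem_FP (nthF_mem_FP 2))
      (fanoutFn_mem_FP (comp_mem_FP fstF_mem_FP (comp_mem_FP fstF_mem_FP (nthF_mem_FP 2)))
        (fanoutFn_mem_FP (comp_mem_FP sndF_mem_FP (comp_mem_FP fstF_mem_FP (nthF_mem_FP 2))) clauseTailB_mem_FP))))

/-- `tokStepB ∈ FP`. [folklore] -/
theorem tokStepB_mem_FP : tokStepB ∈ FP :=
  iteFn_mem_FP (comp_mem_FP isNilFn_mem_FP (nthF_mem_FP 3))
    (iteFn_mem_FP (comp_mem_FP isNilFn_mem_FP (nthF_mem_FP 1)) id_mem_FP clauseB_mem_FP) litB_mem_FP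

/-- **The brick round is the model round.** [folklore] -/
theorem tokStepB_enc (x : List Bool) (s : TokSt) : tokStepB (TokSt.enc x s) = TokSt.enc x s.step := by
  have h3 : (isNilFn ∘ nthF 3) (TokSt.enc x s) = [decide (s.khdr = [])] := by simp [TokSt.enc, isNilFn]
  have h1 : (isNilFn ∘ nthF 1) (TokSt.enc x s) = [decide (s.hdr = [])] := by simp [TokSt.enc, isNilFn]
  rw [tokStepB, iteFn_apply h3, TokSt.step]
  by_cases hk : s.khdr = []
  · rw [if_pos (by simp [hk]), iteFn_apply h1, if_pos hk]
    by_cases hh : s.hdr = []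
    · rw [if_pos (by simp [hh]), if_pos hh]; rfl
    · rw [if_neg (by simp [hh]), if_neg hh]
      simp [clauseB, clauseTailB, TokSt.enc, TokSt.clauseStep, ones, List.replicate_succ]
  · rw [if_neg (by simp [hk]), if_neg hk]
    simp [litB, litTailB, tokOfB, TokSt.enc, TokSt.litStep, ones, List.replicate_succ,
      body_append_singleton, tokRec, List.map_append]

/-- Lengths of the fields of a string: four leading fields and the tail fit in the string.
[folklore] -/
theorem length_fields4_le (w : List Bool) :
    2 * ((nthF 0 w).length + (nthF 1 w).length + (nthF 2 w).length + (nthF 3 w).length) +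
      (sndPow 3 w).length ≤ w.length := by
  have h0 : 2 * (nthF 0 w).length + (sndPow 0 w).length ≤ w.length := length_fstF_sndF_le w
  have h1 : 2 * (nthF 1 w).length + (sndPow 1 w).length ≤ (sndPow 0 w).length :=
    length_nthF_succ_add_sndPow_succ_le 0 w
  have h2 : 2 * (nthF 2 w).length + (sndPow 2 w).length ≤ (sndPow 1 w).length :=
    length_nthF_succ_add_sndPow_succ_le 1 w
  have h3 : 2 * (nthF 3 w).length + (sndPow 3 w).length ≤ (sndPow 2 w).length :=
    length_nthF_succ_add_sndPow_succ_le 2 w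
  omega

/-- Lengths of the fields of a string: five leading fields and the tail fit in the string.
[folklore] -/
theorem length_fields5_le (w : List Bool) :
    2 * ((nthF 0 w).length + (nthF 1 w).length + (nthF 2 w).length + (nthF 3 w).length +
      (nthF 4 w).length) + (sndPow 4 w).length ≤ w.length := by
  have h := length_fields4_le w
  have h4 : 2 * (nthF 4 w).length + (sndPow 4 w).length ≤ (sndPow 3 w).length :=
    length_nthF_succ_add_sndPow_succ_le 3 w
  omega

/-- Lengths of the fields of a string: eight leading fields and the tail fit in the string.
[folklore] -/
theorem length_fields8_le (w : List Bool) :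
    2 * ((nthF 0 w).length + (nthF 1 w).length + (nthF 2 w).length + (nthF 3 w).length +
      (nthF 4 w).length + (nthF 5 w).length + (nthF 6 w).length + (nthF 7 w).length) +
        (sndPow 7 w).length ≤ w.length := by
  have h := length_fields5_le w
  have h5 : 2 * (nthF 5 w).length + (sndPow 5 w).length ≤ (sndPow 4 w).length :=
    length_nthF_succ_add_sndPow_succ_le 4 w
  have h6 : 2 * (nthF 6 w).length + (sndPow 6 w).length ≤ (sndPow 5 w).length :=
    length_nthF_succ_add_sndPow_succ_le 5 w
  have h7 : 2 * (nthF 7 w).length + (sndPow 7 w).length ≤ (sndPow 6 w).length :=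
    length_nthF_succ_add_sndPow_succ_le 6 w
  omega

/-- The literal step lengthens no string by more than `60`. [folklore] -/
theorem length_litB_le (w : List Bool) : (litB w).length ≤ w.length + 60 := by
  have h := length_fields8_le w
  have ha := length_fstF_sndF_le (nthF 4 w)
  have hb := length_fstF_sndF_le (fstF (nthF 4 w))
  have hc : ((nthF 3 w).tail).length ≤ (nthF 3 w).length := by simp
  have hd : (headBitFn (sndF (fstF (nthF 4 w)))).length = 1 := by simp
  simp only [litB, litTailB, accB_apply, tokOfB, fanoutFn_apply, length_boolPair, List.length_append, length_dbl,
    Function.comp_apply, List.length_cons, List.length_nil, hd] at *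
  omega

/-- The clause step lengthens no string by more than `60`. [folklore] -/
theorem length_clauseB_le (w : List Bool) : (clauseB w).length ≤ w.length + 60 := by
  have h := length_fields8_le w
  have ha := length_fstF_sndF_le (nthF 2 w)
  have hb := length_fstF_sndF_le (fstF (nthF 2 w))
  have hc : ((nthF 1 w).tail).length ≤ (nthF 1 w).length := by simp
  simp only [clauseB, clauseTailB, fanoutFn_apply, length_boolPair, Function.comp_apply, List.length_cons,
    List.length_nil] at *
  omega

/-- **One tokenizer round lengthens no string by more than `60`.** [folklore] -/
theorem length_tokStepB_le (w : List Bool) : (tokStepB w).length ≤ w.length + 60 := by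
  rw [tokStepB, iteFn_of_oneBit (oneBit_isNilFn.comp _)]
  split_ifs
  · rw [iteFn_of_oneBit (oneBit_isNilFn.comp _)]
    split_ifs
    · simp
    · exact length_clauseB_le w
  · exact length_litB_le w

/-- The initial state record from the input. [folklore] -/
noncomputable def tokInitB : List Bool → List Bool :=
  fanoutFn id (fanoutFn fstF (fanoutFn sndF fun _ =>
    boolPair [] (boolPair [] (boolPair [false] (boolPair [] (boolPair [] []))))))

/-- `tokInitB ∈ FP`. [folklore] -/
theorem tokInitB_mem_FP : tokInitB ∈ FP :=
  fanoutFn_mem_FP id_mem_FP (fanoutFn_mem_FP fstF_mem_FP (fanoutFn_mem_FP sndF_mem_FP (const_mem_FP _)))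

/-- `tokInitB` builds the initial state record. [folklore] -/
theorem tokInitB_apply (z : List Bool) : tokInitB z = TokSt.enc z (TokSt.init z) := by
  simp [tokInitB, TokSt.enc, TokSt.init]

/-- **The tokenizer** as a string function: `|z|` rounds from the initial record. [folklore] -/
noncomputable def tokFn : List Bool → List Bool :=
  (fun w => tokStepB^[(X : Polynomial ℕ).eval (boolUnpair w).1.length] w) ∘ tokInitB

/-- **`tokFn ∈ FP`.** [folklore] -/
theorem tokFn_mem_FP : tokFn ∈ FP :=
  comp_mem_FP (iterate_mem_FP tokStepB_mem_FP 60 length_tokStepB_le X) tokInitB_mem_FP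

/-- Rounds of the brick are rounds of the model. [folklore] -/
theorem iterate_tokStepB_enc (x : List Bool) : ∀ (n : ℕ) (s : TokSt),
    tokStepB^[n] (TokSt.enc x s) = TokSt.enc x (TokSt.step^[n] s)
  | 0, _ => rfl
  | n + 1, s => by
    rw [Function.iterate_succ_apply, tokStepB_enc, iterate_tokStepB_enc x n, ← Function.iterate_succ_apply]

/-- **The tokenizer computes the record of the final state.** [folklore] -/
theorem tokFn_apply (z : List Bool) : tokFn z = TokSt.enc z (tokState z) := by
  simp only [tokFn, Function.comp_apply, tokInitB_apply]
  rw [show (boolUnpair (TokSt.enc z (TokSt.init z))).1 = z by simp [TokSt.enc], eval_X,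
    iterate_tokStepB_enc]
  rfl

/-- The token-count field of the tokenizer output: `1^L`. [folklore] -/
theorem nthF_six_tokFn (z : List Bool) : nthF 6 (tokFn z) = ones (toks z).length := by
  rw [tokFn_apply, ← ell_tokState]; simp [TokSt.enc]

/-- The clause-count field of the tokenizer output: `1^m`. [folklore] -/
theorem nthF_seven_tokFn (z : List Bool) : nthF 7 (tokFn z) = ones (clauseCount z) := by
  rw [tokFn_apply]; simp [TokSt.enc, clauseCount]

/-- The token field of the tokenizer output: the coded list of token records. [folklore] -/
theorem sndPow_seven_tokFn (z : List Bool) : sndPow 7 (tokFn z) = body ((toks z).map tokRec) := by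
  rw [tokFn_apply]; simp [TokSt.enc, toks]

/-! ### Entry chunks -/

/-- The framed item of an integer in a coded list of integers: `dbl (code v) 0 1`. [folklore] -/
def chunk (v : ℤ) : List Bool :=
  dbl (encodingIntBool.encode v) ++ [false, true]

/-- Unit chunks are short. [folklore] -/
theorem length_chunk_le {v : ℤ} (hv : v = 0 ∨ v = 1 ∨ v = -1) : (chunk v).length ≤ 12 := by
  rcases hv with rfl | rfl | rfl <;> decide

/-- The coded list of integers is the concatenation of their chunks. [folklore] -/
theorem body_map_encode (l : List ℤ) : body (l.map encodingIntBool.encode) = (l.map chunk).flatten := by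
  rw [body_eq_flatMap, List.flatMap_map, List.flatten_eq_flatMap, List.flatMap_map]
  rfl

/-! ### Column tests and emitters -/

/-- The descriptor `⟨row token record, ⟨1^p, ⟨column token record, 1^q⟩⟩⟩` handed to the
emitters. [folklore] -/
def desc (trow P tcol Q : List Bool) : List Bool :=
  boolPair trow (boolPair P (boolPair tcol Q))

/-- Test: equal variable names. [folklore] -/
noncomputable def numEqT : List Bool → List Bool := eqPairFn ∘ fanoutFn (nthF 0 ∘ nthF 0) (nthF 0 ∘ nthF 2)

/-- Test: equal polarities. [folklore] -/
noncomputable def polEqT : List Bool → List Bool := eqPairFn ∘ fanoutFn (nthF 1 ∘ nthF 0) (nthF 1 ∘ nthF 2)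

/-- Test: column position equals row position. [folklore] -/
noncomputable def qEqPT : List Bool → List Bool := eqPairFn ∘ fanoutFn (sndPow 2) (nthF 1)

/-- Test: column position is the successor of the row position. [folklore] -/
noncomputable def qEqSuccPT : List Bool → List Bool := eqPairFn ∘ fanoutFn (sndPow 2) (List.cons true ∘ nthF 1)

/-- Test: the column token opens a clause. [folklore] -/
noncomputable def colFirstT : List Bool → List Bool := headBitFn ∘ sndPow 1 ∘ nthF 2

/-- Test: the column token is the in-clause successor of the row token. [folklore] -/
noncomputable def contT : List Bool → List Bool := andFn qEqSuccPT (notFn colFirstT)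

/-- The tests are in `FP`. [folklore] -/
theorem numEqT_mem_FP : numEqT ∈ FP :=
  comp_mem_FP eqPairFn_mem_FP (fanoutFn_mem_FP (comp_mem_FP (nthF_mem_FP 0) (nthF_mem_FP 0))
    (comp_mem_FP (nthF_mem_FP 0) (nthF_mem_FP 2)))

/-- The tests are in `FP`. [folklore] -/
theorem polEqT_mem_FP : polEqT ∈ FP :=
  comp_mem_FP eqPairFn_mem_FP (fanoutFn_mem_FP (comp_mem_FP (nthF_mem_FP 1) (nthF_mem_FP 0))
    (comp_mem_FP (nthF_mem_FP 1) (nthF_mem_FP 2)))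

/-- The tests are in `FP`. [folklore] -/
theorem qEqPT_mem_FP : qEqPT ∈ FP :=
  comp_mem_FP eqPairFn_mem_FP (fanoutFn_mem_FP (sndPow_mem_FP 2) (nthF_mem_FP 1))

/-- The tests are in `FP`. [folklore] -/
theorem qEqSuccPT_mem_FP : qEqSuccPT ∈ FP :=
  comp_mem_FP eqPairFn_mem_FP (fanoutFn_mem_FP (sndPow_mem_FP 2) (comp_mem_FP (cons_mem_FP true) (nthF_mem_FP 1)))

/-- The tests are in `FP`. [folklore] -/
theorem colFirstT_mem_FP : colFirstT ∈ FP :=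
  comp_mem_FP headBitFn_mem_FP (comp_mem_FP (sndPow_mem_FP 1) (nthF_mem_FP 2))

/-- The tests are in `FP`. [folklore] -/
theorem contT_mem_FP : contT ∈ FP :=
  andFn_mem_FP qEqSuccPT_mem_FP (notFn_mem_FP colFirstT_mem_FP)

/-- `eqPairFn` is one-bit. [folklore] -/
theorem oneBit_eqPairFn : OneBit eqPairFn := fun w => by
  rcases eqPairFn_eq_or w with h | h <;> exact ⟨_, h⟩

/-- The tests are one-bit. [folklore] -/
theorem oneBit_numEqT : OneBit numEqT := oneBit_eqPairFn.comp _

/-- The tests are one-bit. [folklore] -/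
theorem oneBit_polEqT : OneBit polEqT := oneBit_eqPairFn.comp _

/-- The tests are one-bit. [folklore] -/
theorem oneBit_qEqPT : OneBit qEqPT := oneBit_eqPairFn.comp _

/-- The tests are one-bit. [folklore] -/
theorem oneBit_qEqSuccPT : OneBit qEqSuccPT := oneBit_eqPairFn.comp _

/-- The tests are one-bit. [folklore] -/
theorem oneBit_colFirstT : OneBit colFirstT := oneBit_headBitFn.comp _

/-- The tests are one-bit. [folklore] -/
theorem oneBit_contT : OneBit contT := oneBit_andFn oneBit_qEqSuccPT (oneBit_notFn oneBit_colFirstT)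

section TestValues

variable (t t' : STok) (P Q : List Bool)

/-- Value of the variable test on a descriptor. [folklore] -/
theorem numEqT_desc : numEqT (desc (tokRec t) P (tokRec t') Q) = [decide (t.var = t'.var)] := by
  simp [numEqT, desc, eqPairFn_boolPair]

/-- Value of the polarity test on a descriptor. [folklore] -/
theorem polEqT_desc : polEqT (desc (tokRec t) P (tokRec t') Q) = [decide (t.pol = t'.pol)] := by
  simp [polEqT, desc, eqPairFn_boolPair]

/-- Value of the position test on a descriptor. [folklore] -/
theorem qEqPT_desc : qEqPT (desc (tokRec t) P (tokRec t') Q) = [decide (Q = P)] := by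
  simp [qEqPT, desc, eqPairFn_boolPair]

/-- Value of the successor-position test on a descriptor. [folklore] -/
theorem qEqSuccPT_desc : qEqSuccPT (desc (tokRec t) P (tokRec t') Q) = [decide (Q = true :: P)] := by
  simp [qEqSuccPT, desc, eqPairFn_boolPair]

/-- Value of the clause-opening test on a descriptor (any row field). [folklore] -/
theorem colFirstT_desc (trow : List Bool) : colFirstT (desc trow P (tokRec t') Q) = [t'.first] := by
  simp [colFirstT, desc]

/-- Value of the successor-position test on a descriptor (any row field). [folklore] -/
theorem qEqSuccPT_desc' (trow : List Bool) : qEqSuccPT (desc trow P (tokRec t') Q) = [decide (Q = true :: P)] := by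
  simp [qEqSuccPT, desc, eqPairFn_boolPair]

/-- Value of the continuation test on a descriptor (any row field). [folklore] -/
theorem contT_desc (trow : List Bool) : contT (desc trow P (tokRec t') Q) = [decide (Q = true :: P) && !t'.first] := by
  rw [contT, andFn_apply (qEqSuccPT_desc' t' P Q trow) (notFn_apply (colFirstT_desc t' P Q trow))]

end TestValues

/-- The coupling value `(c_p, c_q)` from the two tokens. [folklore] -/
def ccVal (t t' : STok) : ℤ :=
  if t.var = t'.var then (if t.pol = t'.pol then 1 else -1) else 0

/-- The coupling value `(c_p, y_q)` from the positions and the column token. [folklore] -/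
def caVal (p : ℕ) (t' : STok) (q : ℕ) : ℤ :=
  if q = p then 1 else if q = p + 1 ∧ t'.first = false then -1 else 0

/-- The coupling value `(y_p, y_q)`. [folklore] -/
def aaVal (p : ℕ) (t' : STok) (q : ℕ) : ℤ :=
  if q = p + 1 ∧ t'.first = false then 1 else 0

/-- The coupling value `(r, y_q)`. [folklore] -/
def raVal (t' : STok) : ℤ :=
  if t'.first = true then 1 else 0

/-- The values are unit. [folklore] -/
theorem ccVal_unit (t t' : STok) : ccVal t t' = 0 ∨ ccVal t t' = 1 ∨ ccVal t t' = -1 := by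
  unfold ccVal; split_ifs <;> simp

/-- The values are unit. [folklore] -/
theorem caVal_unit (p : ℕ) (t' : STok) (q : ℕ) : caVal p t' q = 0 ∨ caVal p t' q = 1 ∨ caVal p t' q = -1 := by
  unfold caVal; split_ifs <;> simp

/-- The values are unit. [folklore] -/
theorem aaVal_unit (p : ℕ) (t' : STok) (q : ℕ) : aaVal p t' q = 0 ∨ aaVal p t' q = 1 ∨ aaVal p t' q = -1 := by
  unfold aaVal; split_ifs <;> simp

/-- The values are unit. [folklore] -/
theorem raVal_unit (t' : STok) : raVal t' = 0 ∨ raVal t' = 1 ∨ raVal t' = -1 := by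
  unfold raVal; split_ifs <;> simp

/-- **Emitter of a copy row**: the chunks of `(c_p, c_q)` and `(c_p, y_q)`. [folklore] -/
noncomputable def emitC : List Bool → List Bool :=
  concatFn ∘ fanoutFn (iteFn numEqT (iteFn polEqT (fun _ => chunk 1) (fun _ => chunk (-1))) (fun _ => chunk 0))
    (iteFn qEqPT (fun _ => chunk 1) (iteFn contT (fun _ => chunk (-1)) (fun _ => chunk 0)))

/-- **Emitter of an auxiliary row**: the chunks of `(y_p, c_q) = 0` and `(y_p, y_q)`. [folklore] -/
noncomputable def emitY : List Bool → List Bool :=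
  (fun w => chunk 0 ++ w) ∘ iteFn contT (fun _ => chunk 1) (fun _ => chunk 0)

/-- **Emitter of the reference row**: the chunks of `(r, c_q) = 0` and `(r, y_q)`. [folklore] -/
noncomputable def emitR : List Bool → List Bool :=
  (fun w => chunk 0 ++ w) ∘ iteFn colFirstT (fun _ => chunk 1) (fun _ => chunk 0)

/-- **Emitter of the pair counter**: a `1` per column token on the row token's variable. [folklore] -/
noncomputable def emitCnt : List Bool → List Bool :=
  iteFn numEqT (fun _ => [true]) (fun _ => [])

/-- The emitters are in `FP`. [folklore] -/
theorem emitC_mem_FP : emitC ∈ FP :=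
  comp_mem_FP concatFn_mem_FP (fanoutFn_mem_FP
    (iteFn_mem_FP numEqT_mem_FP (iteFn_mem_FP polEqT_mem_FP (const_mem_FP _) (const_mem_FP _)) (const_mem_FP _))
    (iteFn_mem_FP qEqPT_mem_FP (const_mem_FP _) (iteFn_mem_FP contT_mem_FP (const_mem_FP _) (const_mem_FP _))))

/-- The emitters are in `FP`. [folklore] -/
theorem emitY_mem_FP : emitY ∈ FP :=
  comp_mem_FP (prefix_mem_FP _) (iteFn_mem_FP contT_mem_FP (const_mem_FP _) (const_mem_FP _))

/-- The emitters are in `FP`. [folklore] -/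
theorem emitR_mem_FP : emitR ∈ FP :=
  comp_mem_FP (prefix_mem_FP _) (iteFn_mem_FP colFirstT_mem_FP (const_mem_FP _) (const_mem_FP _))

/-- The emitters are in `FP`. [folklore] -/
theorem emitCnt_mem_FP : emitCnt ∈ FP :=
  iteFn_mem_FP numEqT_mem_FP (const_mem_FP _) (const_mem_FP _)

/-- The emitters are short on every input. [folklore] -/
theorem length_emitC_le (d : List Bool) : (emitC d).length ≤ 24 := by
  have h0 := length_chunk_le (Or.inl rfl)
  have h1 := length_chunk_le (Or.inr (Or.inl rfl))
  have h2 := length_chunk_le (Or.inr (Or.inr rfl))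
  simp only [emitC, Function.comp_apply, fanoutFn_apply, concatFn_boolPair, List.length_append]
  rw [iteFn_of_oneBit oneBit_numEqT, iteFn_of_oneBit oneBit_polEqT, iteFn_of_oneBit oneBit_qEqPT,
    iteFn_of_oneBit oneBit_contT]
  split_ifs <;> omega

/-- The emitters are short on every input. [folklore] -/
theorem length_emitY_le (d : List Bool) : (emitY d).length ≤ 24 := by
  have h0 := length_chunk_le (Or.inl rfl)
  have h1 := length_chunk_le (Or.inr (Or.inl rfl))
  simp only [emitY, Function.comp_apply, List.length_append]
  rw [iteFn_of_oneBit oneBit_contT]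
  split_ifs <;> omega

/-- The emitters are short on every input. [folklore] -/
theorem length_emitR_le (d : List Bool) : (emitR d).length ≤ 24 := by
  have h0 := length_chunk_le (Or.inl rfl)
  have h1 := length_chunk_le (Or.inr (Or.inl rfl))
  simp only [emitR, Function.comp_apply, List.length_append]
  rw [iteFn_of_oneBit oneBit_colFirstT]
  split_ifs <;> omega

/-- The emitters are short on every input. [folklore] -/
theorem length_emitCnt_le (d : List Bool) : (emitCnt d).length ≤ 24 := by
  rw [emitCnt, iteFn_of_oneBit oneBit_numEqT]
  split_ifs <;> simp

/-- `1^q = 1^p` iff `q = p`. [folklore] -/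
theorem ones_eq_ones_iff (q p : ℕ) : ones q = ones p ↔ q = p :=
  ⟨fun h => by simpa using congrArg List.length h, fun h => by rw [h]⟩

/-- `1^q = 1 1^p` iff `q = p + 1`. [folklore] -/
theorem ones_eq_true_cons_ones_iff (q p : ℕ) : ones q = true :: ones p ↔ q = p + 1 := by
  rw [show true :: ones p = ones (p + 1) by simp [ones, List.replicate_succ], ones_eq_ones_iff]

section EmitValues

variable (t t' : STok) (p q : ℕ)

/-- **Value of the copy-row emitter.** [folklore] -/
theorem emitC_desc : emitC (desc (tokRec t) (ones p) (tokRec t') (ones q)) = chunk (ccVal t t') ++ chunk (caVal p t' q) := by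
  simp only [emitC, Function.comp_apply, fanoutFn_apply, concatFn_boolPair]
  rw [iteFn_apply (numEqT_desc _ _ _ _), iteFn_apply (polEqT_desc _ _ _ _), iteFn_apply (qEqPT_desc _ _ _ _),
    iteFn_apply (contT_desc _ _ _ (tokRec t))]
  simp only [ones_eq_ones_iff, ones_eq_true_cons_ones_iff]
  unfold ccVal caVal
  by_cases h1 : t.var = t'.var <;> by_cases h2 : t.pol = t'.pol <;> by_cases h3 : q = p <;>
    by_cases h4 : q = p + 1 <;> cases h5 : t'.first <;> simp [h1, h2, h3, h4]

/-- **Value of the auxiliary-row emitter.** [folklore] -/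
theorem emitY_desc (trow : List Bool) : emitY (desc trow (ones p) (tokRec t') (ones q)) = chunk 0 ++ chunk (aaVal p t' q) := by
  simp only [emitY, Function.comp_apply]
  rw [iteFn_apply (contT_desc _ _ _ trow)]
  simp only [ones_eq_true_cons_ones_iff]
  unfold aaVal
  by_cases h4 : q = p + 1 <;> cases h5 : t'.first <;> simp [h4]

/-- **Value of the reference-row emitter.** [folklore] -/
theorem emitR_desc (trow P Q : List Bool) : emitR (desc trow P (tokRec t') Q) = chunk 0 ++ chunk (raVal t') := by
  simp only [emitR, Function.comp_apply]
  rw [iteFn_apply (colFirstT_desc _ _ _ trow)]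
  unfold raVal
  cases h5 : t'.first <;> simp

/-- **Value of the counting emitter.** [folklore] -/
theorem emitCnt_desc (P Q : List Bool) :
    emitCnt (desc (tokRec t) P (tokRec t') Q) = if t.var = t'.var then [true] else [] := by
  rw [emitCnt, iteFn_apply (numEqT_desc _ _ _ _)]
  by_cases h : t.var = t'.var <;> simp [h]

end EmitValues

/-! ### The row loop -/

/-- The row-loop state `⟨x, ⟨trow, ⟨P, ⟨rem, ⟨Q, out⟩⟩⟩⟩⟩`: ruler, row token record, row position,
remaining column items, column position, output. [folklore] -/
def rowSt (x trow P rem Q out : List Bool) : List Bool :=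
  boolPair x (boolPair trow (boolPair P (boolPair rem (boolPair Q out))))

/-- The descriptor of the current column, from the row-loop state. [folklore] -/
noncomputable def descB : List Bool → List Bool :=
  fanoutFn (nthF 1) (fanoutFn (nthF 2) (fanoutFn (fstF ∘ nthF 3) (nthF 4)))

/-- **One round of the row loop** with emitter `E`: if column items are left, emit `E` of the
descriptor, drop the item and advance the column position. [folklore] -/
noncomputable def rowStepB (E : List Bool → List Bool) : List Bool → List Bool :=
  iteFn (isNilFn ∘ nthF 3) id
    (fanoutFn (nthF 0) (fanoutFn (nthF 1) (fanoutFn (nthF 2) (fanoutFn (sndF ∘ nthF 3)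
      (fanoutFn (List.cons true ∘ nthF 4) (concatFn ∘ fanoutFn (sndPow 4) (E ∘ descB)))))))

variable {E : List Bool → List Bool} {cE : ℕ}

/-- `descB ∈ FP`. [folklore] -/
theorem descB_mem_FP : descB ∈ FP :=
  fanoutFn_mem_FP (nthF_mem_FP 1) (fanoutFn_mem_FP (nthF_mem_FP 2)
    (fanoutFn_mem_FP (comp_mem_FP fstF_mem_FP (nthF_mem_FP 3)) (nthF_mem_FP 4)))

/-- `rowStepB E ∈ FP` for `E ∈ FP`. [folklore] -/
theorem rowStepB_mem_FP (hE : E ∈ FP) : rowStepB E ∈ FP :=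
  iteFn_mem_FP (comp_mem_FP isNilFn_mem_FP (nthF_mem_FP 3)) id_mem_FP
    (fanoutFn_mem_FP (nthF_mem_FP 0) (fanoutFn_mem_FP (nthF_mem_FP 1) (fanoutFn_mem_FP (nthF_mem_FP 2)
      (fanoutFn_mem_FP (comp_mem_FP sndF_mem_FP (nthF_mem_FP 3))
        (fanoutFn_mem_FP (comp_mem_FP (cons_mem_FP true) (nthF_mem_FP 4))
          (comp_mem_FP concatFn_mem_FP (fanoutFn_mem_FP (sndPow_mem_FP 4) (comp_mem_FP hE descB_mem_FP))))))))

/-- **A row-loop round lengthens no string by more than `cE + 12`.** [folklore] -/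
theorem length_rowStepB_le (hcE : ∀ d, (E d).length ≤ cE) (w : List Bool) :
    (rowStepB E w).length ≤ w.length + (cE + 12) := by
  rw [rowStepB, iteFn_of_oneBit (oneBit_isNilFn.comp _)]
  split_ifs
  · simp
  · have h := length_fields5_le w
    have ha := length_fstF_sndF_le (nthF 3 w)
    have he := hcE (descB w)
    simp only [fanoutFn_apply, length_boolPair, List.length_append, Function.comp_apply,
      List.length_cons, concatFn_boolPair] at *
    omega

/-- A finished row loop idles. [folklore] -/
theorem rowStepB_nil (x trow P Q out : List Bool) : rowStepB E (rowSt x trow P [] Q out) = rowSt x trow P [] Q out := by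
  rw [rowStepB, iteFn_apply (b := true) (by simp [rowSt, isNilFn])]
  simp

/-- A running row loop emits one column, from any state with a nonempty item field. [folklore] -/
theorem rowStepB_of_ne_nil (x trow P rem Q out : List Bool) (h : rem ≠ []) :
    rowStepB E (rowSt x trow P rem Q out) =
      rowSt x trow P (sndF rem) (true :: Q) (out ++ E (desc trow P (fstF rem) Q)) := by
  rw [rowStepB, iteFn_apply (b := false) (by simp [rowSt, isNilFn, h])]
  simp [rowSt, descB, desc]

/-- A running row loop emits one column. [folklore] -/
theorem rowStepB_cons (x trow P a rem Q out : List Bool) :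
    rowStepB E (rowSt x trow P (boolPair a rem) Q out) =
      rowSt x trow P rem (true :: Q) (out ++ E (desc trow P a Q)) := by
  rw [rowStepB_of_ne_nil x trow P _ Q out (boolPair_ne_nil a rem)]
  simp

/-- The model of the row loop: the emitted columns for the items `l` from column position `Q`.
[folklore] -/
def rowM (E : List Bool → List Bool) (trow P : List Bool) : List (List Bool) → List Bool → List Bool
  | [], _ => []
  | a :: l, Q => E (desc trow P a Q) ++ rowM E trow P l (true :: Q)

/-- **The row loop realises its model**: with at least `|l|` rounds, all items are consumed.
[folklore] -/
theorem iterate_rowStepB (x trow P : List Bool) : ∀ (l : List (List Bool)) (n : ℕ) (Q out : List Bool),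
    l.length ≤ n → (rowStepB E)^[n] (rowSt x trow P (body l) Q out) =
      rowSt x trow P [] (ones l.length ++ Q) (out ++ rowM E trow P l Q)
  | [], n, Q, out, _ => by
    rw [body_nil, Function.iterate_fixed (rowStepB_nil x trow P Q out)]
    simp [rowM, ones]
  | a :: l, 0, Q, out, h => by simp at h
  | a :: l, n + 1, Q, out, h => by
    rw [Function.iterate_succ_apply, body_cons, rowStepB_cons, iterate_rowStepB x trow P l n _ _
      (by simpa using h)]
    simp [rowM, ones, List.replicate_succ', List.append_assoc]

/-- The output of a row loop grows by at most `cE` per round, from any state. [folklore] -/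
theorem length_out_iterate_rowStepB_le (hcE : ∀ d, (E d).length ≤ cE) (x trow P : List Bool) :
    ∀ (n : ℕ) (rem Q out : List Bool),
      (sndPow 4 ((rowStepB E)^[n] (rowSt x trow P rem Q out))).length ≤ out.length + n * cE
  | 0, rem, Q, out => by simp [rowSt]
  | n + 1, rem, Q, out => by
    rw [Function.iterate_succ_apply]
    by_cases h : rem = []
    · subst h
      rw [rowStepB_nil]
      exact (length_out_iterate_rowStepB_le hcE x trow P n [] Q out).trans (by nlinarith)
    · rw [rowStepB_of_ne_nil x trow P rem Q out h]
      refine (length_out_iterate_rowStepB_le hcE x trow P n _ _ _).trans ?_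
      have := hcE (desc trow P (fstF rem) Q)
      simp only [List.length_append]
      nlinarith

/-- **The row function** with emitter `E`: `|x|` rounds of the row loop, then the output field.
[folklore] -/
noncomputable def rowFnB (E : List Bool → List Bool) : List Bool → List Bool :=
  sndPow 4 ∘ fun w => (rowStepB E)^[(X : Polynomial ℕ).eval (boolUnpair w).1.length] w

/-- `rowFnB E ∈ FP`. [folklore] -/
theorem rowFnB_mem_FP (hE : E ∈ FP) (hcE : ∀ d, (E d).length ≤ cE) : rowFnB E ∈ FP :=
  comp_mem_FP (sndPow_mem_FP 4) (iterate_mem_FP (rowStepB_mem_FP hE) (cE + 12) (length_rowStepB_le hcE) X)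

/-- **Value of the row function** on a coded item list with at most `|x|` items. [folklore] -/
theorem rowFnB_apply (x trow P : List Bool) (l : List (List Bool)) (hl : l.length ≤ x.length) :
    rowFnB E (rowSt x trow P (body l) [] []) = rowM E trow P l [] := by
  simp only [rowFnB, Function.comp_apply]
  rw [show (boolUnpair (rowSt x trow P (body l) [] [])).1 = x by simp [rowSt], eval_X,
    iterate_rowStepB x trow P l x.length [] [] hl]
  simp [rowSt]

/-- The row function's output is at most `cE |x|` long, on any row state. [folklore] -/
theorem length_rowFnB_rowSt_le (hcE : ∀ d, (E d).length ≤ cE) (x trow P rem : List Bool) :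
    (rowFnB E (rowSt x trow P rem [] [])).length ≤ x.length * cE := by
  simp only [rowFnB, Function.comp_apply]
  rw [show (boolUnpair (rowSt x trow P rem [] [])).1 = x by simp [rowSt], eval_X]
  simpa using length_out_iterate_rowStepB_le hcE x trow P x.length rem [] []

/-! ### The matrix loop -/

/-- The matrix-loop state `⟨x, ⟨A, ⟨remR, ⟨P, OUT⟩⟩⟩⟩`: ruler, all column items, remaining row
items, row position, output. [folklore] -/
def matSt (x A remR P OUT : List Bool) : List Bool :=
  boolPair x (boolPair A (boolPair remR (boolPair P OUT)))

/-- The initial row-loop state for the current row item. [folklore] -/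
noncomputable def rowInitB : List Bool → List Bool :=
  fanoutFn (nthF 0) (fanoutFn (fstF ∘ nthF 2) (fanoutFn (nthF 3) (fanoutFn (nthF 1) fun _ => boolPair [] [])))

/-- `rowInitB ∈ FP`. [folklore] -/
theorem rowInitB_mem_FP : rowInitB ∈ FP :=
  fanoutFn_mem_FP (nthF_mem_FP 0) (fanoutFn_mem_FP (comp_mem_FP fstF_mem_FP (nthF_mem_FP 2))
    (fanoutFn_mem_FP (nthF_mem_FP 3) (fanoutFn_mem_FP (nthF_mem_FP 1) (const_mem_FP _))))

/-- `rowInitB` is a row state on every input. [folklore] -/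
theorem rowInitB_eq (w : List Bool) :
    rowInitB w = rowSt (nthF 0 w) (fstF (nthF 2 w)) (nthF 3 w) (nthF 1 w) [] [] := by
  simp [rowInitB, rowSt]

/-- `rowInitB` on a matrix state. [folklore] -/
theorem rowInitB_matSt (x A remR P OUT : List Bool) :
    rowInitB (matSt x A remR P OUT) = rowSt x (fstF remR) P A [] [] := by
  simp [rowInitB, rowSt, matSt]

section MatLoop

variable (Ec Ey : List Bool → List Bool) (pre : List Bool)

/-- The two rows (copy row, auxiliary row) of the current row token, each with the prefix `pre`
(the reference-column chunk). [folklore] -/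
noncomputable def twoRowsB : List Bool → List Bool :=
  concatFn ∘ fanoutFn ((fun w => pre ++ w) ∘ rowFnB Ec ∘ rowInitB) ((fun w => pre ++ w) ∘ rowFnB Ey ∘ rowInitB)

/-- Value of `twoRowsB`. [folklore] -/
theorem twoRowsB_apply (w : List Bool) :
    twoRowsB Ec Ey pre w = (pre ++ rowFnB Ec (rowInitB w)) ++ (pre ++ rowFnB Ey (rowInitB w)) := by
  simp [twoRowsB]

/-- **One round of the matrix loop**: if row items are left, emit the two rows of the first one,
drop it and advance the row position. [folklore] -/
noncomputable def matStepB : List Bool → List Bool :=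
  iteFn (isNilFn ∘ nthF 2) id
    (fanoutFn (nthF 0) (fanoutFn (nthF 1) (fanoutFn (sndF ∘ nthF 2)
      (fanoutFn (List.cons true ∘ nthF 3) (concatFn ∘ fanoutFn (sndPow 3) (twoRowsB Ec Ey pre))))))

/-- The model of the matrix loop: two rows per row item, against all column items `all`.
[folklore] -/
def matM (all : List (List Bool)) : List (List Bool) → List Bool → List Bool
  | [], _ => []
  | a :: l, P => ((pre ++ rowM Ec a P all []) ++ (pre ++ rowM Ey a P all [])) ++ matM all l (true :: P)

variable {Ec Ey pre} {cc cy : ℕ}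

/-- `twoRowsB ∈ FP`. [folklore] -/
theorem twoRowsB_mem_FP (hEc : Ec ∈ FP) (hcc : ∀ d, (Ec d).length ≤ cc) (hEy : Ey ∈ FP)
    (hcy : ∀ d, (Ey d).length ≤ cy) : twoRowsB Ec Ey pre ∈ FP :=
  comp_mem_FP concatFn_mem_FP (fanoutFn_mem_FP
    (comp_mem_FP (prefix_mem_FP pre) (comp_mem_FP (rowFnB_mem_FP hEc hcc) rowInitB_mem_FP))
    (comp_mem_FP (prefix_mem_FP pre) (comp_mem_FP (rowFnB_mem_FP hEy hcy) rowInitB_mem_FP)))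

/-- `matStepB ∈ FP`. [folklore] -/
theorem matStepB_mem_FP (hEc : Ec ∈ FP) (hcc : ∀ d, (Ec d).length ≤ cc) (hEy : Ey ∈ FP)
    (hcy : ∀ d, (Ey d).length ≤ cy) : matStepB Ec Ey pre ∈ FP :=
  iteFn_mem_FP (comp_mem_FP isNilFn_mem_FP (nthF_mem_FP 2)) id_mem_FP
    (fanoutFn_mem_FP (nthF_mem_FP 0) (fanoutFn_mem_FP (nthF_mem_FP 1)
      (fanoutFn_mem_FP (comp_mem_FP sndF_mem_FP (nthF_mem_FP 2))
        (fanoutFn_mem_FP (comp_mem_FP (cons_mem_FP true) (nthF_mem_FP 3))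
          (comp_mem_FP concatFn_mem_FP (fanoutFn_mem_FP (sndPow_mem_FP 3) (twoRowsB_mem_FP hEc hcc hEy hcy)))))))

/-- The two rows are at most `2 |pre| + (cc + cy) |x|` long, on every input. [folklore] -/
theorem length_twoRowsB_le (hcc : ∀ d, (Ec d).length ≤ cc) (hcy : ∀ d, (Ey d).length ≤ cy) (w : List Bool) :
    (twoRowsB Ec Ey pre w).length ≤ 2 * pre.length + (cc + cy) * (fstF w).length := by
  have h1 := length_rowFnB_rowSt_le hcc (nthF 0 w) (fstF (nthF 2 w)) (nthF 3 w) (nthF 1 w)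
  have h2 := length_rowFnB_rowSt_le hcy (nthF 0 w) (fstF (nthF 2 w)) (nthF 3 w) (nthF 1 w)
  rw [← rowInitB_eq] at h1 h2
  simp only [twoRowsB_apply, List.length_append, nthF_zero] at *
  nlinarith

/-- The matrix loop keeps the ruler. [folklore] -/
theorem fstF_matStepB (w : List Bool) : (boolUnpair (matStepB Ec Ey pre w)).1 = (boolUnpair w).1 := by
  rw [matStepB, iteFn_of_oneBit (oneBit_isNilFn.comp _)]
  split_ifs
  · rfl
  · simp [fstF]

/-- **Linear growth of a matrix-loop round.** [folklore] -/
theorem length_matStepB_le (hcc : ∀ d, (Ec d).length ≤ cc) (hcy : ∀ d, (Ey d).length ≤ cy) (w : List Bool) :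
    (matStepB Ec Ey pre w).length ≤ w.length + (2 * pre.length + cc + cy + 12) * ((boolUnpair w).1.length + 1) := by
  rw [matStepB, iteFn_of_oneBit (oneBit_isNilFn.comp _)]
  split_ifs
  · simp
  · have h := length_fields4_le w
    have ha := length_fstF_sndF_le (nthF 2 w)
    have ht := length_twoRowsB_le (pre := pre) hcc hcy w
    have hx : (fstF w).length = (boolUnpair w).1.length := rfl
    simp only [nthF_zero, fanoutFn_apply, length_boolPair, List.length_append, Function.comp_apply,
      List.length_cons, concatFn_boolPair] at *
    nlinarith

/-- A finished matrix loop idles. [folklore] -/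
theorem matStepB_nil (x A P OUT : List Bool) : matStepB Ec Ey pre (matSt x A [] P OUT) = matSt x A [] P OUT := by
  rw [matStepB, iteFn_apply (b := true) (by simp [matSt, isNilFn])]
  simp

/-- A running matrix loop emits two rows. [folklore] -/
theorem matStepB_cons (x a remR P OUT : List Bool) (all : List (List Bool)) (hall : all.length ≤ x.length) :
    matStepB Ec Ey pre (matSt x (body all) (boolPair a remR) P OUT) =
      matSt x (body all) remR (true :: P) (OUT ++ ((pre ++ rowM Ec a P all []) ++ (pre ++ rowM Ey a P all []))) := by
  rw [matStepB, iteFn_apply (b := false) (by simp [matSt, isNilFn, boolPair_ne_nil])]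
  have h : rowInitB (matSt x (body all) (boolPair a remR) P OUT) = rowSt x a P (body all) [] [] := by
    rw [rowInitB_matSt, fstF_boolPair]
  simp only [fanoutFn_apply, twoRowsB_apply, h, rowFnB_apply x a P all hall, Function.comp_apply,
    concatFn_boolPair]
  simp [matSt]

/-- **The matrix loop realises its model.** [folklore] -/
theorem iterate_matStepB (x : List Bool) (all : List (List Bool)) (hall : all.length ≤ x.length) :
    ∀ (l : List (List Bool)) (n : ℕ) (P OUT : List Bool), l.length ≤ n →
      (matStepB Ec Ey pre)^[n] (matSt x (body all) (body l) P OUT) =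
        matSt x (body all) [] (ones l.length ++ P) (OUT ++ matM Ec Ey pre all l P)
  | [], n, P, OUT, _ => by
    rw [body_nil, Function.iterate_fixed (matStepB_nil x _ P OUT)]
    simp [matM, ones]
  | a :: l, 0, P, OUT, h => by simp at h
  | a :: l, n + 1, P, OUT, h => by
    rw [Function.iterate_succ_apply, body_cons, matStepB_cons x a _ P OUT all hall,
      iterate_matStepB x all hall l n _ _ (by simpa using h)]
    simp [matM, ones, List.replicate_succ', List.append_assoc]

/-- The initial matrix state from `⟨x, A⟩`: `⟨x, ⟨A, ⟨A, ⟨ε, ε⟩⟩⟩⟩`. [folklore] -/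
noncomputable def matInitB : List Bool → List Bool :=
  fanoutFn fstF (fanoutFn sndF (fanoutFn sndF fun _ => boolPair [] []))

/-- `matInitB ∈ FP`. [folklore] -/
theorem matInitB_mem_FP : matInitB ∈ FP :=
  fanoutFn_mem_FP fstF_mem_FP (fanoutFn_mem_FP sndF_mem_FP (fanoutFn_mem_FP sndF_mem_FP (const_mem_FP _)))

/-- `matInitB ⟨x, A⟩ = ⟨x, ⟨A, ⟨A, ⟨ε, ε⟩⟩⟩⟩`. [folklore] -/
theorem matInitB_boolPair (x A : List Bool) : matInitB (boolPair x A) = matSt x A A [] [] := by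
  simp [matInitB, matSt]

variable (Ec Ey pre) in
/-- **The matrix function**: `|x|` rounds of the matrix loop from the initial state, then the
output field. [folklore] -/
noncomputable def matFnB : List Bool → List Bool :=
  sndPow 3 ∘ (fun w => (matStepB Ec Ey pre)^[(X : Polynomial ℕ).eval (boolUnpair w).1.length] w) ∘ matInitB

/-- **`matFnB ∈ FP`.** [folklore] -/
theorem matFnB_mem_FP (hEc : Ec ∈ FP) (hcc : ∀ d, (Ec d).length ≤ cc) (hEy : Ey ∈ FP)
    (hcy : ∀ d, (Ey d).length ≤ cy) : matFnB Ec Ey pre ∈ FP :=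
  comp_mem_FP (sndPow_mem_FP 3) (comp_mem_FP (iterate_mem_FP_of_growth (matStepB_mem_FP hEc hcc hEy hcy) _
    fstF_matStepB (length_matStepB_le hcc hcy) X) matInitB_mem_FP)

/-- **Value of the matrix function** on `⟨x, coded items⟩` with at most `|x|` items. [folklore] -/
theorem matFnB_apply (x : List Bool) (all : List (List Bool)) (hall : all.length ≤ x.length) :
    matFnB Ec Ey pre (boolPair x (body all)) = matM Ec Ey pre all all [] := by
  simp only [matFnB, Function.comp_apply, matInitB_boolPair]
  rw [show (boolUnpair (matSt x (body all) (body all) [] [])).1 = x by simp [matSt], eval_X,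
    iterate_matStepB x all hall all x.length [] [] hall]
  simp [matSt]

end MatLoop

/-! ### The item function: reference row, then the matrix loop -/

/-- The initial row state of the reference row from `⟨x, A⟩`: `⟨x, ⟨ε, ⟨ε, ⟨A, ⟨ε, ε⟩⟩⟩⟩⟩`. [folklore] -/
noncomputable def refRowInitB : List Bool → List Bool :=
  fanoutFn fstF (fanoutFn (fun _ => []) (fanoutFn (fun _ => []) (fanoutFn sndF fun _ => boolPair [] [])))

/-- `refRowInitB ∈ FP`. [folklore] -/
theorem refRowInitB_mem_FP : refRowInitB ∈ FP :=
  fanoutFn_mem_FP fstF_mem_FP (fanoutFn_mem_FP (const_mem_FP _) (fanoutFn_mem_FP (const_mem_FP _)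
    (fanoutFn_mem_FP sndF_mem_FP (const_mem_FP _))))

/-- `refRowInitB ⟨x, A⟩`. [folklore] -/
theorem refRowInitB_boolPair (x A : List Bool) : refRowInitB (boolPair x A) = rowSt x [] [] A [] [] := by
  simp [refRowInitB, rowSt]

section Items

variable (Ec Ey Er : List Bool → List Bool) (pre : List Bool)

/-- **The item function**: the reference row followed by the rows of the matrix loop. [folklore] -/
noncomputable def itemsB : List Bool → List Bool :=
  concatFn ∘ fanoutFn ((fun w => pre ++ w) ∘ rowFnB Er ∘ refRowInitB) (matFnB Ec Ey pre)

/-- Its model. [folklore] -/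
def itemsM (all : List (List Bool)) : List Bool :=
  (pre ++ rowM Er [] [] all []) ++ matM Ec Ey pre all all []

variable {Ec Ey Er pre} {cc cy cr : ℕ}

/-- **`itemsB ∈ FP`.** [folklore] -/
theorem itemsB_mem_FP (hEc : Ec ∈ FP) (hcc : ∀ d, (Ec d).length ≤ cc) (hEy : Ey ∈ FP)
    (hcy : ∀ d, (Ey d).length ≤ cy) (hEr : Er ∈ FP) (hcr : ∀ d, (Er d).length ≤ cr) :
    itemsB Ec Ey Er pre ∈ FP :=
  comp_mem_FP concatFn_mem_FP (fanoutFn_mem_FP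
    (comp_mem_FP (prefix_mem_FP pre) (comp_mem_FP (rowFnB_mem_FP hEr hcr) refRowInitB_mem_FP))
    (matFnB_mem_FP hEc hcc hEy hcy))

/-- **Value of the item function.** [folklore] -/
theorem itemsB_apply (x : List Bool) (all : List (List Bool)) (hall : all.length ≤ x.length) :
    itemsB Ec Ey Er pre (boolPair x (body all)) = itemsM Ec Ey Er pre all := by
  simp only [itemsB, Function.comp_apply, fanoutFn_apply, concatFn_boolPair, refRowInitB_boolPair,
    rowFnB_apply x [] [] all hall, matFnB_apply x all hall, itemsM]

end Items


/-! ### The emitted items are the chunks of the coupling matrix -/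

section Bridge

/-- Rows by list recursion: `f` of each token with a running column counter. [folklore] -/
def rowList (f : STok → ℕ → List Bool) : List STok → ℕ → List Bool
  | [], _ => []
  | t :: l, q => f t q ++ rowList f l (q + 1)

/-- The row model on token records with unary positions is a `rowList`. [folklore] -/
theorem rowM_map_tokRec (E : List Bool → List Bool) (trow P : List Bool) (f : STok → ℕ → List Bool)
    (hE : ∀ t' q, E (desc trow P (tokRec t') (ones q)) = f t' q) :
    ∀ (l : List STok) (q : ℕ), rowM E trow P (l.map tokRec) (ones q) = rowList f l q
  | [], _ => rfl
  | t :: l, q => by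
    rw [List.map_cons, rowM, hE, rowList, show true :: ones q = ones (q + 1) by simp [ones, List.replicate_succ],
      rowM_map_tokRec E trow P f hE l (q + 1)]

/-- Indexed rows are `rowList`s. [folklore] -/
theorem flatten_ofFn_eq_rowList (f : STok → ℕ → List Bool) :
    ∀ (l : List STok) (q : ℕ), (List.ofFn fun i : Fin l.length => f l[i] (q + i)).flatten = rowList f l q
  | [], _ => rfl
  | t :: l, q => by
    rw [List.ofFn_succ, List.flatten_cons, rowList, ← flatten_ofFn_eq_rowList f l (q + 1)]
    refine congrArg₂ (· ++ ·) (by simp) (congrArg List.flatten (List.ofFn_inj.2 (funext fun i => ?_)))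
    simp [Nat.add_assoc, Nat.add_comm 1]

variable (T : List STok)

/-- The row-major list of the entries of `J_T`, as coded by `encodingIntMatrixFin`. [folklore] -/
def matrixEntries : List ℤ :=
  List.ofFn fun m : Fin ((T.length * 2 + 1) * (T.length * 2 + 1)) =>
    J T (finProdFinEquiv.symm m).1 (finProdFinEquiv.symm m).2

/-- Row-major order is rows of columns. [folklore] -/
theorem matrixEntries_eq :
    matrixEntries T = (List.ofFn fun i : Fin (T.length * 2 + 1) =>
      List.ofFn fun j : Fin (T.length * 2 + 1) => J T i j).flatten := by
  rw [matrixEntries, List.ofFn_mul]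
  refine congrArg List.flatten (List.ofFn_inj.2 (funext fun i => List.ofFn_inj.2 (funext fun j => ?_)))
  have h : ∀ hlt : i.val * (T.length * 2 + 1) + j.val < (T.length * 2 + 1) * (T.length * 2 + 1),
      finProdFinEquiv.symm (⟨i.val * (T.length * 2 + 1) + j.val, hlt⟩ : Fin ((T.length * 2 + 1) * (T.length * 2 + 1))) =
        (i, j) := fun hlt => by
    rw [Equiv.symm_apply_eq]
    exact Fin.ext (by simp [Nat.mul_comm]; ring)
  simp only [h]

/-- Entity of an index by its value: the reference spin. [folklore] -/
theorem ent_of_val_zero {L : ℕ} (i : Fin (L * 2 + 1)) (h : i.val = 0) : ent L i = none :=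
  (ent_eq_iff i none).2 h

/-- Entity of an index by its value: a copy spin. [folklore] -/
theorem ent_of_val_copy {L : ℕ} (i : Fin (L * 2 + 1)) (p : Fin L) (h : i.val = 2 * p.val + 1) :
    ent L i = some (p, false) :=
  (ent_eq_iff i _).2 (by simpa [idxN] using h)

/-- Entity of an index by its value: an auxiliary spin. [folklore] -/
theorem ent_of_val_aux {L : ℕ} (i : Fin (L * 2 + 1)) (p : Fin L) (h : i.val = 2 * p.val + 2) :
    ent L i = some (p, true) :=
  (ent_eq_iff i _).2 (by simp [idxN]; omega)

section JValues

variable {T} {i j : Fin (T.length * 2 + 1)} {p q : Fin T.length}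

/-- Entries of `J_T` by entity: `(r, r)`. [folklore] -/
theorem J_zero_zero (hi : i.val = 0) (hj : j.val = 0) : J T i j = 0 := by
  simp [J, ent_of_val_zero i hi, ent_of_val_zero j hj, coupling]

/-- Entries of `J_T` by entity: `(r, c_q)`. [folklore] -/
theorem J_zero_copy (hi : i.val = 0) (hj : j.val = 2 * q.val + 1) : J T i j = 0 := by
  simp [J, ent_of_val_zero i hi, ent_of_val_copy j q hj, coupling]

/-- Entries of `J_T` by entity: `(r, y_q)`. [folklore] -/
theorem J_zero_aux (hi : i.val = 0) (hj : j.val = 2 * q.val + 2) : J T i j = raVal T[q] := by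
  simp [J, ent_of_val_zero i hi, ent_of_val_aux j q hj, coupling, raVal]

/-- Entries of `J_T` by entity: `(c_p, r)`. [folklore] -/
theorem J_copy_zero (hi : i.val = 2 * p.val + 1) (hj : j.val = 0) : J T i j = 0 := by
  simp [J, ent_of_val_copy i p hi, ent_of_val_zero j hj, coupling]

/-- Entries of `J_T` by entity: `(y_p, r)`. [folklore] -/
theorem J_aux_zero (hi : i.val = 2 * p.val + 2) (hj : j.val = 0) : J T i j = 0 := by
  simp [J, ent_of_val_aux i p hi, ent_of_val_zero j hj, coupling]

/-- Entries of `J_T` by entity: `(c_p, c_q)`. [folklore] -/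
theorem J_copy_copy (hi : i.val = 2 * p.val + 1) (hj : j.val = 2 * q.val + 1) : J T i j = ccVal T[p] T[q] := by
  simp [J, ent_of_val_copy i p hi, ent_of_val_copy j q hj, coupling, ccVal, pm]

/-- Entries of `J_T` by entity: `(c_p, y_q)`. [folklore] -/
theorem J_copy_aux (hi : i.val = 2 * p.val + 1) (hj : j.val = 2 * q.val + 2) :
    J T i j = caVal p.val T[q] q.val := by
  simp only [J, ent_of_val_copy i p hi, ent_of_val_aux j q hj, coupling, caVal, Rel, Fin.ext_iff]
  congr

/-- Entries of `J_T` by entity: `(y_p, c_q)`. [folklore] -/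
theorem J_aux_copy (hi : i.val = 2 * p.val + 2) (hj : j.val = 2 * q.val + 1) : J T i j = 0 := by
  simp [J, ent_of_val_aux i p hi, ent_of_val_copy j q hj, coupling]

/-- Entries of `J_T` by entity: `(y_p, y_q)`. [folklore] -/
theorem J_aux_aux (hi : i.val = 2 * p.val + 2) (hj : j.val = 2 * q.val + 2) :
    J T i j = aaVal p.val T[q] q.val := by
  simp only [J, ent_of_val_aux i p hi, ent_of_val_aux j q hj, coupling, aaVal, Rel]
  congr

end JValues

/-- Splitting an enumeration over `2L + 1` indices into the head and `L` pairs. [folklore] -/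
theorem flatten_ofFn_two_mul_succ {β : Type} (L : ℕ) (g : Fin (L * 2 + 1) → List β) :
    (List.ofFn g).flatten = g 0 ++ (List.ofFn fun p : Fin L =>
      g ⟨2 * p.val + 1, by omega⟩ ++ g ⟨2 * p.val + 2, by omega⟩).flatten := by
  rw [List.ofFn_succ, List.flatten_cons, List.ofFn_mul, List.flatten_flatten, List.map_ofFn]
  refine congrArg₂ (· ++ ·) rfl (congrArg List.flatten (List.ofFn_inj.2 (funext fun p => ?_)))
  simp only [Function.comp_apply, List.ofFn_succ, List.ofFn_zero, List.flatten_cons, List.flatten_nil,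
    List.append_nil]
  have h1 : ∀ hlt : p.val * 2 + (0 : Fin 2).val < L * 2,
      (⟨p.val * 2 + (0 : Fin 2).val, hlt⟩ : Fin (L * 2)).succ = ⟨2 * p.val + 1, by omega⟩ := fun _ =>
    Fin.ext (by simp; ring)
  have h2 : ∀ hlt : p.val * 2 + (Fin.succ (0 : Fin 1)).val < L * 2,
      (⟨p.val * 2 + (Fin.succ (0 : Fin 1)).val, hlt⟩ : Fin (L * 2)).succ = ⟨2 * p.val + 2, by omega⟩ := fun _ =>
    Fin.ext (by simp; ring)
  rw [h1, h2]

/-- The string of a row: the chunks of its entries. [folklore] -/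
def rowStr (i : Fin (T.length * 2 + 1)) : List Bool :=
  (List.ofFn fun j : Fin (T.length * 2 + 1) => chunk (J T i j)).flatten

/-- The coded entry list, row by row. [folklore] -/
theorem flatten_map_chunk_matrixEntries :
    ((matrixEntries T).map chunk).flatten =
      rowStr T 0 ++ (List.ofFn fun p : Fin T.length =>
        rowStr T ⟨2 * p.val + 1, by omega⟩ ++ rowStr T ⟨2 * p.val + 2, by omega⟩).flatten := by
  have e : ((matrixEntries T).map chunk).flatten = (List.ofFn (rowStr T)).flatten := by
    rw [matrixEntries_eq, List.map_flatten, List.flatten_flatten, List.map_map, List.map_ofFn]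
    refine congrArg List.flatten (List.ofFn_inj.2 (funext fun i => ?_))
    simp only [Function.comp_apply, rowStr, List.map_ofFn]
    rfl
  rw [e]
  exact flatten_ofFn_two_mul_succ _ (rowStr T)

/-- The row of the reference spin. [folklore] -/
theorem rowStr_zero : rowStr T 0 = chunk 0 ++ rowList (fun t' _ => chunk 0 ++ chunk (raVal t')) T 0 := by
  rw [rowStr, flatten_ofFn_two_mul_succ, J_zero_zero rfl rfl, ← flatten_ofFn_eq_rowList]
  refine congrArg₂ (· ++ ·) rfl (congrArg List.flatten (List.ofFn_inj.2 (funext fun q => ?_)))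
  rw [J_zero_copy (q := q) rfl rfl, J_zero_aux (q := q) rfl rfl]

/-- The row of a copy spin. [folklore] -/
theorem rowStr_copy (p : Fin T.length) :
    rowStr T ⟨2 * p.val + 1, by omega⟩ =
      chunk 0 ++ rowList (fun t' q => chunk (ccVal T[p] t') ++ chunk (caVal p.val t' q)) T 0 := by
  rw [rowStr, flatten_ofFn_two_mul_succ, J_copy_zero (p := p) rfl rfl, ← flatten_ofFn_eq_rowList]
  refine congrArg₂ (· ++ ·) rfl (congrArg List.flatten (List.ofFn_inj.2 (funext fun q => ?_)))
  rw [J_copy_copy (p := p) (q := q) rfl rfl, J_copy_aux (p := p) (q := q) rfl rfl, Nat.zero_add]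

/-- The row of an auxiliary spin. [folklore] -/
theorem rowStr_aux (p : Fin T.length) :
    rowStr T ⟨2 * p.val + 2, by omega⟩ =
      chunk 0 ++ rowList (fun t' q => chunk 0 ++ chunk (aaVal p.val t' q)) T 0 := by
  rw [rowStr, flatten_ofFn_two_mul_succ, J_aux_zero (p := p) rfl rfl, ← flatten_ofFn_eq_rowList]
  refine congrArg₂ (· ++ ·) rfl (congrArg List.flatten (List.ofFn_inj.2 (funext fun q => ?_)))
  rw [J_aux_copy (p := p) (q := q) rfl rfl, J_aux_aux (p := p) (q := q) rfl rfl, Nat.zero_add]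

/-- The two rows of a token as a function of the token and its position. [folklore] -/
def twoRowsOf (t : STok) (p : ℕ) : List Bool :=
  (chunk 0 ++ rowList (fun t' q => chunk (ccVal t t') ++ chunk (caVal p t' q)) T 0) ++
    (chunk 0 ++ rowList (fun t' q => chunk 0 ++ chunk (aaVal p t' q)) T 0)

/-- The matrix model on token records: two rows per token. [folklore] -/
theorem matM_map_tokRec : ∀ (l : List STok) (p : ℕ),
    matM emitC emitY (chunk 0) (T.map tokRec) (l.map tokRec) (ones p) =
      (List.ofFn fun i : Fin l.length => twoRowsOf T l[i] (p + i)).flatten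
  | [], _ => rfl
  | t :: l, p => by
    rw [List.map_cons, matM, show true :: ones p = ones (p + 1) by simp [ones, List.replicate_succ],
      matM_map_tokRec l (p + 1), List.ofFn_succ, List.flatten_cons]
    congr 1
    · have h1 : rowM emitC (tokRec t) (ones p) (T.map tokRec) [] =
          rowList (fun t' q => chunk (ccVal t t') ++ chunk (caVal p t' q)) T 0 :=
        rowM_map_tokRec emitC _ _ (fun t' q => chunk (ccVal t t') ++ chunk (caVal p t' q))
          (fun t' q => emitC_desc t t' p q) T 0
      have h2 : rowM emitY (tokRec t) (ones p) (T.map tokRec) [] =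
          rowList (fun t' q => chunk 0 ++ chunk (aaVal p t' q)) T 0 :=
        rowM_map_tokRec emitY _ _ (fun t' q => chunk 0 ++ chunk (aaVal p t' q)) (fun t' q => emitY_desc t' p q _) T 0
      rw [h1, h2]
      simp [twoRowsOf]
    · refine congrArg List.flatten (List.ofFn_inj.2 (funext fun i => ?_))
      simp [Nat.add_assoc, Nat.add_comm 1]

/-- **The items model is the coded entry list of `J_T`.** [folklore] -/
theorem itemsM_eq : itemsM emitC emitY emitR (chunk 0) (T.map tokRec) = ((matrixEntries T).map chunk).flatten := by
  rw [flatten_map_chunk_matrixEntries, itemsM, rowStr_zero]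
  have h1 : rowM emitR [] [] (T.map tokRec) [] = rowList (fun t' _ => chunk 0 ++ chunk (raVal t')) T 0 :=
    rowM_map_tokRec emitR [] [] (fun t' _ => chunk 0 ++ chunk (raVal t')) (fun t' q => emitR_desc t' [] [] _) T 0
  have h2 : matM emitC emitY (chunk 0) (T.map tokRec) (T.map tokRec) [] =
      (List.ofFn fun i : Fin T.length => twoRowsOf T T[i] (0 + i)).flatten :=
    matM_map_tokRec T T 0
  rw [h1, h2]
  refine congrArg₂ (· ++ ·) rfl (congrArg List.flatten (List.ofFn_inj.2 (funext fun p => ?_)))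
  rw [rowStr_copy, rowStr_aux, twoRowsOf, Nat.zero_add]

end Bridge


/-! ### The query: the code of the Ising instance of `z` at `β = 3n + 3`, accuracy `1/4` -/

section Query

/-- `⟨z, coded token records⟩` from the tokenizer output record. [folklore] -/
noncomputable def itemsInB : List Bool → List Bool :=
  fanoutFn (nthF 0) (sndPow 7)

/-- `itemsInB ∈ FP`. [folklore] -/
theorem itemsInB_mem_FP : itemsInB ∈ FP :=
  fanoutFn_mem_FP (nthF_mem_FP 0) (sndPow_mem_FP 7)

/-- `itemsInB` on the tokenizer output. [folklore] -/
theorem itemsInB_tokFn (z : List Bool) : itemsInB (tokFn z) = boolPair z (body ((toks z).map tokRec)) := by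
  rw [itemsInB, fanoutFn_apply, sndPow_seven_tokFn, tokFn_apply]
  simp [TokSt.enc]

/-- `1^n`, `n = 2L + 1` the number of spins, from the tokenizer output record. [folklore] -/
noncomputable def unB : List Bool → List Bool :=
  List.cons true ∘ concatFn ∘ fanoutFn (nthF 6) (nthF 6)

/-- `unB ∈ FP`. [folklore] -/
theorem unB_mem_FP : unB ∈ FP :=
  comp_mem_FP (cons_mem_FP true) (comp_mem_FP concatFn_mem_FP (fanoutFn_mem_FP (nthF_mem_FP 6) (nthF_mem_FP 6)))

/-- The number of spins of the instance read off `z`. [folklore] -/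
def nSpins (z : List Bool) : ℕ :=
  (toks z).length * 2 + 1

/-- `unB` on the tokenizer output is `1^n`. [folklore] -/
theorem unB_tokFn (z : List Bool) : unB (tokFn z) = ones (nSpins z) := by
  simp only [unB, Function.comp_apply, fanoutFn_apply, concatFn_boolPair, nthF_six_tokFn, nSpins, ones]
  rw [Nat.mul_two, List.replicate_succ, List.replicate_add]

/-- The matrix code `⟨encodeNat n, ⟨1^{n²}, items⟩⟩` from the tokenizer output record. [folklore] -/
noncomputable def matrixCodeB : List Bool → List Bool :=
  fanoutFn (popCountFn ∘ unB) (fanoutFn (umulFn ∘ fanoutFn unB unB) (itemsB emitC emitY emitR (chunk 0) ∘ itemsInB))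

/-- `matrixCodeB ∈ FP`. [folklore] -/
theorem matrixCodeB_mem_FP : matrixCodeB ∈ FP :=
  fanoutFn_mem_FP (comp_mem_FP popCountFn_mem_FP unB_mem_FP)
    (fanoutFn_mem_FP (comp_mem_FP umulFn_mem_FP (fanoutFn_mem_FP unB_mem_FP unB_mem_FP))
      (comp_mem_FP (itemsB_mem_FP emitC_mem_FP length_emitC_le emitY_mem_FP length_emitY_le emitR_mem_FP
        length_emitR_le) itemsInB_mem_FP))

/-- **The coupling matrix of the instance read off `z`.** [folklore] -/
def matrixOf (z : List Bool) : Matrix (Fin (nSpins z)) (Fin (nSpins z)) ℤ :=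
  J (toks z)

/-- The `listBool` code of a list is the pair of its unary length and the body of the item codes.
[folklore] -/
theorem listBool_encode_eq_boolPair {γ : Type} (e : Encoding γ Bool) (l : List γ) :
    e.listBool.encode l = boolPair (ones l.length) (body (l.map e.encode)) := by
  change boolPair (unaryEncodeNat l.length) (l.foldr (fun a acc => boolPair (e.encode a) acc) []) = _
  rw [OracleCompose.unaryEncodeNat_eq_replicate]
  congr 1
  induction l with
  | nil => rfl
  | cons a l ih => simp [ih]

/-- **The matrix code is the code of the Ising instance `⟨n, J(toks z)⟩`.** [folklore] -/
theorem matrixCodeB_tokFn (z : List Bool) :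
    matrixCodeB (tokFn z) = encodingIntMatrix.encode ⟨nSpins z, matrixOf z⟩ := by
  rw [encodingIntMatrix_encode, matrixCodeB, fanoutFn_apply, fanoutFn_apply, Function.comp_apply,
    Function.comp_apply, Function.comp_apply, fanoutFn_apply, unB_tokFn, itemsInB_tokFn, umulFn_boolPair,
    popCountFn_apply, List.count_replicate_self,
    itemsB_apply z _ (by simpa using length_toks_le z), itemsM_eq, ← body_map_encode]
  congr 1
  change _ = encodingIntBool.listBool.encode (matrixEntries (toks z))
  rw [listBool_encode_eq_boolPair, matrixEntries, List.length_ofFn, ← matrixEntries]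
  rfl

/-- The query `⟨matrix code, ⟨1^{3n+3}, 1^3⟩⟩` from the tokenizer output record. [folklore] -/
noncomputable def qryRecB : List Bool → List Bool :=
  fanoutFn matrixCodeB (fanoutFn (concatFn ∘ fanoutFn unB (concatFn ∘ fanoutFn unB
    (concatFn ∘ fanoutFn unB fun _ => [true, true, true]))) fun _ => [true, true, true])

/-- `qryRecB ∈ FP`. [folklore] -/
theorem qryRecB_mem_FP : qryRecB ∈ FP :=
  fanoutFn_mem_FP matrixCodeB_mem_FP (fanoutFn_mem_FP (comp_mem_FP concatFn_mem_FP (fanoutFn_mem_FP unB_mem_FP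
    (comp_mem_FP concatFn_mem_FP (fanoutFn_mem_FP unB_mem_FP (comp_mem_FP concatFn_mem_FP
      (fanoutFn_mem_FP unB_mem_FP (const_mem_FP _))))))) (const_mem_FP _))

/-- **The query function** `z ↦` the thermal-energy query for the Ising instance read off `z`, at
inverse temperature `3n + 3` and accuracy `1/4`. [folklore] -/
noncomputable def qryFn : List Bool → List Bool :=
  qryRecB ∘ tokFn

/-- **`qryFn ∈ FP`.** [folklore] -/
theorem qryFn_mem_FP : qryFn ∈ FP :=
  comp_mem_FP qryRecB_mem_FP tokFn_mem_FP

/-- **Value of the query function.** [folklore] -/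
theorem qryFn_apply (z : List Bool) :
    qryFn z = thermalQuery ⟨nSpins z, matrixOf z⟩ (3 * nSpins z + 3) 3 := by
  rw [thermalQuery, ← matrixCodeB_tokFn, qryFn, Function.comp_apply, qryRecB, fanoutFn_apply, fanoutFn_apply,
    OracleCompose.unaryEncodeNat_eq_replicate, OracleCompose.unaryEncodeNat_eq_replicate]
  simp only [Function.comp_apply, fanoutFn_apply, concatFn_boolPair, unB_tokFn, ones]
  congr 2
  rw [show 3 * nSpins z + 3 = nSpins z + (nSpins z + (nSpins z + 3)) by ring, List.replicate_add, List.replicate_add,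
    List.replicate_add]
  rfl

end Query

/-! ### The decision: compare the oracle's answer with the threshold -/

section Decision

/-- Rows of an emitter that emits nothing are empty. [folklore] -/
theorem rowM_const_nil (trow P : List Bool) : ∀ (l : List (List Bool)) (Q : List Bool),
    rowM (fun _ => []) trow P l Q = []
  | [], _ => rfl
  | _ :: l, Q => by rw [rowM, rowM_const_nil trow P l]; rfl

/-- The count string of a token list: a `1` for every ordered pair of tokens on the same variable.
[folklore] -/
noncomputable def countStr (T : List STok) : List Bool :=
  itemsM emitCnt (fun _ => []) (fun _ => []) [] (T.map tokRec)

/-- The count string as nested `rowList`s. [folklore] -/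
theorem countStr_eq (T : List STok) : countStr T =
    (List.ofFn fun i : Fin T.length => rowList (fun t' _ => if (T[i]).var = t'.var then [true] else []) T 0).flatten := by
  rw [countStr, itemsM, rowM_const_nil, List.nil_append, List.nil_append]
  suffices h : ∀ (l : List STok) (p : ℕ), matM emitCnt (fun _ => []) [] (T.map tokRec) (l.map tokRec) (ones p) =
      (List.ofFn fun i : Fin l.length => rowList (fun t' _ => if (l[i]).var = t'.var then [true] else []) T 0).flatten by
    exact h T 0
  intro l
  induction l with
  | nil => intro p; rfl
  | cons t l ih =>
    intro p
    have h : rowM emitCnt (tokRec t) (ones p) (T.map tokRec) [] =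
        rowList (fun t' _ => if t.var = t'.var then [true] else []) T 0 :=
      rowM_map_tokRec emitCnt _ _ (fun t' _ => if t.var = t'.var then [true] else [])
        (fun t' q => emitCnt_desc t t' _ _) T 0
    rw [List.map_cons, matM, rowM_const_nil, show true :: ones p = ones (p + 1) by simp [ones, List.replicate_succ],
      ih (p + 1), List.ofFn_succ, List.flatten_cons, h]
    simp only [List.nil_append, List.append_nil, List.length_cons]
    rfl

/-- Every symbol of a count row is `1`, and there are as many as matching tokens. [folklore] -/
theorem rowList_count (t : STok) : ∀ (l : List STok) (q : ℕ),
    rowList (fun t' _ => if t.var = t'.var then [true] else []) l q =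
      ones (l.map fun t' => if t.var = t'.var then 1 else 0).sum
  | [], _ => rfl
  | t' :: l, q => by
    rw [rowList, rowList_count t l (q + 1), List.map_cons, List.sum_cons]
    by_cases h : t.var = t'.var <;> simp [h, ones, List.replicate_add]

/-- The number of ordered pairs of tokens on the same variable (diagonal included). [folklore] -/
def orderedPairCount (T : List STok) : ℕ :=
  ∑ p : Fin T.length, ∑ q : Fin T.length, if (T[p]).var = (T[q]).var then 1 else 0

/-- Concatenated blocks of ones. [folklore] -/
theorem flatten_map_ones : ∀ l : List ℕ, (l.map ones).flatten = ones l.sum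
  | [] => rfl
  | a :: l => by
    rw [List.map_cons, List.flatten_cons, flatten_map_ones l, List.sum_cons]
    exact List.replicate_append_replicate

/-- **The count string is `1^{#ordered pairs}`.** [folklore] -/
theorem countStr_eq_ones (T : List STok) : countStr T = ones (orderedPairCount T) := by
  rw [countStr_eq]
  have h1 : ∀ i : Fin T.length, rowList (fun t' _ => if (T[i]).var = t'.var then [true] else []) T 0 =
      ones (∑ q : Fin T.length, if (T[i]).var = (T[q]).var then 1 else 0) := by
    intro i
    rw [rowList_count]
    congr 1
    simp only [Fin.getElem_fin]
    exact (List.sum_ofFn.symm.trans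
      (congrArg List.sum (List.ofFn_getElem_eq_map T fun t' => if (T[i.val]).var = t'.var then 1 else 0))).symm
  simp only [h1]
  rw [orderedPairCount, ← List.sum_ofFn, ← flatten_map_ones, List.map_ofFn]
  rfl

/-- `orderedPairCount = 2 P + L`. [folklore] -/
theorem orderedPairCount_eq_two_mul (T : List STok) : orderedPairCount T = 2 * pairCount T + T.length :=
  orderedPairCount_eq T

/-- The count string from the tokenizer output record. [folklore] -/
noncomputable def cntB : List Bool → List Bool :=
  itemsB emitCnt (fun _ => []) (fun _ => []) [] ∘ itemsInB

/-- `cntB ∈ FP`. [folklore] -/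
theorem cntB_mem_FP : cntB ∈ FP :=
  comp_mem_FP (itemsB_mem_FP emitCnt_mem_FP length_emitCnt_le (const_mem_FP _) (fun _ => by simp)
    (const_mem_FP _) (fun _ => by simp) (cc := 24) (cy := 0) (cr := 0)) itemsInB_mem_FP

/-- `cntB` on the tokenizer output. [folklore] -/
theorem cntB_tokFn (z : List Bool) : cntB (tokFn z) = ones (2 * pairCount (toks z) + (toks z).length) := by
  rw [cntB, Function.comp_apply, itemsInB_tokFn, itemsB_apply z _ (by simpa using length_toks_le z), ← countStr,
    countStr_eq_ones, orderedPairCount_eq_two_mul]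

/-- **The threshold magnitude** `N(z) = P + L + m`: pairs of occurrences of one variable, literal
occurrences, clauses. [folklore] -/
def thresholdN (z : List Bool) : ℕ :=
  pairCount (toks z) + (toks z).length + clauseCount z

/-- `1^{4N}` from the tokenizer output record: twice the count string, twice `1^L`, four times
`1^m`. [folklore] -/
noncomputable def u4NB : List Bool → List Bool :=
  concatFn ∘ fanoutFn cntB (concatFn ∘ fanoutFn cntB (concatFn ∘ fanoutFn (nthF 6) (concatFn ∘ fanoutFn (nthF 6)
    (concatFn ∘ fanoutFn (nthF 7) (concatFn ∘ fanoutFn (nthF 7) (concatFn ∘ fanoutFn (nthF 7) (nthF 7)))))))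

/-- `u4NB ∈ FP`. [folklore] -/
theorem u4NB_mem_FP : u4NB ∈ FP :=
  comp_mem_FP concatFn_mem_FP (fanoutFn_mem_FP cntB_mem_FP (comp_mem_FP concatFn_mem_FP (fanoutFn_mem_FP cntB_mem_FP
    (comp_mem_FP concatFn_mem_FP (fanoutFn_mem_FP (nthF_mem_FP 6) (comp_mem_FP concatFn_mem_FP
      (fanoutFn_mem_FP (nthF_mem_FP 6) (comp_mem_FP concatFn_mem_FP (fanoutFn_mem_FP (nthF_mem_FP 7)
        (comp_mem_FP concatFn_mem_FP (fanoutFn_mem_FP (nthF_mem_FP 7) (comp_mem_FP concatFn_mem_FP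
          (fanoutFn_mem_FP (nthF_mem_FP 7) (nthF_mem_FP 7))))))))))))))

/-- `u4NB` on the tokenizer output is `1^{4N}`. [folklore] -/
theorem u4NB_tokFn (z : List Bool) : u4NB (tokFn z) = ones (4 * thresholdN z) := by
  simp only [u4NB, Function.comp_apply, fanoutFn_apply, concatFn_boolPair, cntB_tokFn, nthF_six_tokFn,
    nthF_seven_tokFn, ones, ← List.replicate_add, thresholdN]
  congr 1
  ring

/-- `encodeNat (4N)` from the tokenizer output record. [folklore] -/
noncomputable def b4NB : List Bool → List Bool :=
  popCountFn ∘ u4NB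

/-- `b4NB ∈ FP`. [folklore] -/
theorem b4NB_mem_FP : b4NB ∈ FP :=
  comp_mem_FP popCountFn_mem_FP u4NB_mem_FP

/-- `b4NB` on the tokenizer output. [folklore] -/
theorem b4NB_tokFn (z : List Bool) : b4NB (tokFn z) = encodeNat (4 * thresholdN z) := by
  rw [b4NB, Function.comp_apply, u4NB_tokFn, popCountFn_apply, ones, List.count_replicate_self]

/-- **The decision function** on `⟨z, a⟩`, `a` the code of the oracle's integer answer: with
`K = -N(z)`, test `a < 4K + 3`, i.e. `4N < |a| + 3` for negative `a` and `4N + a < 3` otherwise.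
[folklore] -/
noncomputable def decFn : List Bool → List Bool :=
  iteFn (headBitFn ∘ fstF ∘ sndF)
    (ltFn ∘ fanoutFn (b4NB ∘ tokFn ∘ fstF) (addFn ∘ fanoutFn (sndF ∘ sndF) fun _ => encodeNat 3))
    (ltFn ∘ fanoutFn (addFn ∘ fanoutFn (b4NB ∘ tokFn ∘ fstF) (sndF ∘ sndF)) fun _ => encodeNat 3)

/-- **`decFn ∈ FP`.** [folklore] -/
theorem decFn_mem_FP : decFn ∈ FP :=
  iteFn_mem_FP (comp_mem_FP headBitFn_mem_FP (comp_mem_FP fstF_mem_FP sndF_mem_FP))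
    (comp_mem_FP ltFn_mem_FP (fanoutFn_mem_FP (comp_mem_FP b4NB_mem_FP (comp_mem_FP tokFn_mem_FP fstF_mem_FP))
      (comp_mem_FP addFn_mem_FP (fanoutFn_mem_FP (comp_mem_FP sndF_mem_FP sndF_mem_FP) (const_mem_FP _)))))
    (comp_mem_FP ltFn_mem_FP (fanoutFn_mem_FP (comp_mem_FP addFn_mem_FP (fanoutFn_mem_FP
      (comp_mem_FP b4NB_mem_FP (comp_mem_FP tokFn_mem_FP fstF_mem_FP)) (comp_mem_FP sndF_mem_FP sndF_mem_FP)))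
        (const_mem_FP _)))

/-- `decFn` is one-bit. [folklore] -/
theorem oneBit_decFn : OneBit decFn :=
  (oneBit_headBitFn.comp _).ite (oneBit_ltFn.comp _) (oneBit_ltFn.comp _)

/-- **Value of the decision function on a genuine answer**: `[a < 3 - 4N(z)]`. [folklore] -/
theorem decFn_boolPair (z : List Bool) (a : ℤ) :
    decFn (boolPair z (encodingIntBool.encode a)) = [decide (a < 3 - 4 * (thresholdN z : ℤ))] := by
  have henc : encodingIntBool.encode a = boolPair [decide (a < 0)] (encodeNat a.natAbs) := rfl
  rw [decFn, henc]
  by_cases ha : a < 0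
  · rw [iteFn_apply (b := true) (by simp [ha]), if_pos rfl]
    simp only [Function.comp_apply, fanoutFn_apply, fstF_boolPair, sndF_boolPair, b4NB_tokFn, addFn_boolPair,
      bitsToNat_encodeNat, ltFn_boolPair]
    congr 1
    apply Bool.decide_congr
    omega
  · rw [iteFn_apply (b := false) (by simp [ha])]
    simp only [Bool.false_eq_true, if_false, Function.comp_apply, fanoutFn_apply, fstF_boolPair, sndF_boolPair,
      b4NB_tokFn, addFn_boolPair, bitsToNat_encodeNat, ltFn_boolPair]
    congr 1
    apply Bool.decide_congr
    omega

end Decision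


/-! ### The tokenizer on the code of a CNF -/

section ValidCodes

/-- The code of a literal. [folklore] -/
theorem encodingLiteral_encode (l : Literal ℕ) : encodingLiteral.encode l = boolPair (encodeNat l.1) [l.2] := rfl

/-- The code of a clause. [folklore] -/
theorem encodingClause_encode (c : Clause ℕ) :
    encodingClause.encode c = boolPair (ones c.length) (body (c.map encodingLiteral.encode)) :=
  listBool_encode_eq_boolPair _ c

/-- The code of a CNF. [folklore] -/
theorem encodingCNF_encode (φ : CNF ℕ) :
    encodingCNF.encode φ = boolPair (ones φ.length) (body (φ.map encodingClause.encode)) :=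
  listBool_encode_eq_boolPair _ φ

/-- Renaming a literal's variable into its binary numeral. [folklore] -/
def strLit (l : Literal ℕ) : Literal (List Bool) :=
  (encodeNat l.1, l.2)

/-- The string tokens of a clause: variable names in binary. [folklore] -/
def clauseTokensStr (b : Bool) (c : Clause ℕ) : List STok :=
  clauseTokens b (c.map strLit)

/-- The string tokens of a CNF: variable names in binary. [folklore] -/
def tokensStr (φ : CNF ℕ) : List STok :=
  tokens (φ.map fun c => c.map strLit)

/-- `tokensStr` clause by clause. [folklore] -/
theorem tokensStr_cons (c : Clause ℕ) (φ : CNF ℕ) : tokensStr (c :: φ) = clauseTokensStr true c ++ tokensStr φ := by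
  simp [tokensStr, clauseTokensStr, tokens]

/-- A clause has as many tokens as literals. [folklore] -/
theorem length_clauseTokens {γ : Type} : ∀ (b : Bool) (c : Clause γ), (clauseTokens b c).length = c.length
  | _, [] => rfl
  | b, _ :: c => by rw [clauseTokens, List.length_cons, length_clauseTokens false c, List.length_cons]

/-- A clause has as many string tokens as literals. [folklore] -/
theorem length_clauseTokensStr (b : Bool) (c : Clause ℕ) : (clauseTokensStr b c).length = c.length := by
  rw [clauseTokensStr, length_clauseTokens, List.length_map]

/-- **The literal rounds of one clause.** From a state whose current clause holds the literals `c`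
(`khdr = 1^{|c|}`, `lbody` their coded list), `|c|` rounds emit the tokens of `c` and exhaust the
clause. [folklore] -/
theorem iterate_step_clause : ∀ (c : Clause ℕ) (hdr bdy : List Bool) (f : Bool) (ell mc : ℕ) (tk : List STok),
    TokSt.step^[c.length] ⟨hdr, bdy, ones c.length, body (c.map encodingLiteral.encode), f, ell, mc, tk⟩ =
      ⟨hdr, bdy, [], [], (c.isEmpty && f), ell + c.length, mc, tk ++ clauseTokensStr f c⟩
  | [], hdr, bdy, f, ell, mc, tk => by simp [clauseTokensStr, clauseTokens]
  | l :: c, hdr, bdy, f, ell, mc, tk => by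
    rw [List.length_cons, Function.iterate_succ_apply]
    have h1 : TokSt.step ⟨hdr, bdy, ones (c.length + 1), body ((l :: c).map encodingLiteral.encode), f, ell, mc, tk⟩ =
        ⟨hdr, bdy, ones c.length, body (c.map encodingLiteral.encode), false, ell + 1, mc,
          tk ++ [⟨encodeNat l.1, l.2, f⟩]⟩ := by
      simp [TokSt.step, ones, List.replicate_succ, TokSt.litStep, encodingLiteral_encode]
    rw [h1, iterate_step_clause c]
    simp [clauseTokensStr, clauseTokens, strLit, List.append_assoc, Nat.add_assoc, Nat.add_comm 1]

/-- The number of tokenizer rounds spent on a clause list: one per clause and one per literal.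
[folklore] -/
def roundsOf (φ : CNF ℕ) : ℕ :=
  (φ.map fun c => c.length + 1).sum

/-- The clause-opening flag after a clause list. [folklore] -/
def flagAfter : Bool → CNF ℕ → Bool
  | f, [] => f
  | _, c :: φ => flagAfter c.isEmpty φ

/-- **The rounds of a clause list.** From a state holding the clause list `φ` (`hdr = 1^{|φ|}`, `bdy`
their coded list, current clause exhausted), `roundsOf φ` rounds emit the tokens of `φ`, count its
clauses and exhaust it. [folklore] -/
theorem iterate_step_cnf : ∀ (φ : CNF ℕ) (f : Bool) (ell mc : ℕ) (tk : List STok),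
    TokSt.step^[roundsOf φ] ⟨ones φ.length, body (φ.map encodingClause.encode), [], [], f, ell, mc, tk⟩ =
      ⟨[], [], [], [], flagAfter f φ, ell + (tokensStr φ).length, mc + φ.length, tk ++ tokensStr φ⟩
  | [], f, ell, mc, tk => by simp [roundsOf, flagAfter, tokensStr, tokens]
  | c :: φ, f, ell, mc, tk => by
    have hr : roundsOf (c :: φ) = (roundsOf φ + c.length) + 1 := by simp [roundsOf]; ring
    rw [hr, Function.iterate_succ_apply, Function.iterate_add_apply]
    have h1 : TokSt.step ⟨ones (φ.length + 1), body ((c :: φ).map encodingClause.encode), [], [], f, ell, mc, tk⟩ =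
        ⟨ones φ.length, body (φ.map encodingClause.encode), ones c.length, body (c.map encodingLiteral.encode), true,
          ell, mc + 1, tk⟩ := by
      simp [TokSt.step, ones, List.replicate_succ, TokSt.clauseStep, encodingClause_encode]
    rw [List.length_cons, h1, iterate_step_clause c, iterate_step_cnf φ]
    simp only [Bool.and_true, flagAfter, tokensStr_cons, List.length_append, length_clauseTokensStr, List.append_assoc,
      TokSt.mk.injEq, and_true, true_and]
    constructor <;> ring

/-- An exhausted tokenizer state is fixed. [folklore] -/
theorem step_exhausted (f : Bool) (ell mc : ℕ) (tk : List STok) :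
    TokSt.step ⟨[], [], [], [], f, ell, mc, tk⟩ = ⟨[], [], [], [], f, ell, mc, tk⟩ := by
  simp [TokSt.step]

/-- The code of a CNF is at least as long as the number of tokenizer rounds it needs. [folklore] -/
theorem roundsOf_le_length_encode (φ : CNF ℕ) : roundsOf φ ≤ (encodingCNF.encode φ).length := by
  rw [encodingCNF_encode, length_boolPair, body_eq_flatMap, List.length_flatMap]
  unfold roundsOf
  have h : ∀ c : Clause ℕ, c.length + 1 ≤ (dbl (encodingClause.encode c) ++ [false, true]).length := by
    intro c
    rw [List.length_append, length_dbl, encodingClause_encode, length_boolPair]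
    simp [ones]
    omega
  have := List.sum_le_sum (l := φ) fun c _ => h c
  rw [List.map_map]
  exact this.trans (Nat.le_add_left _ _)

/-- **The tokenizer on the code of a CNF reads off its string tokens …** [folklore] -/
theorem toks_encode (φ : CNF ℕ) : toks (encodingCNF.encode φ) = tokensStr φ := by
  have hN := roundsOf_le_length_encode φ
  obtain ⟨d, hd⟩ := Nat.exists_eq_add_of_le hN
  have hinit : TokSt.init (encodingCNF.encode φ) = ⟨ones φ.length, body (φ.map encodingClause.encode), [], [], false, 0, 0, []⟩ := by
    simp [TokSt.init, encodingCNF_encode]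
  rw [toks, tokState, hd, Nat.add_comm, Function.iterate_add_apply, hinit, iterate_step_cnf,
    Function.iterate_fixed (step_exhausted _ _ _ _)]
  simp

/-- **… and counts its clauses.** [folklore] -/
theorem clauseCount_encode (φ : CNF ℕ) : clauseCount (encodingCNF.encode φ) = φ.length := by
  have hN := roundsOf_le_length_encode φ
  obtain ⟨d, hd⟩ := Nat.exists_eq_add_of_le hN
  have hinit : TokSt.init (encodingCNF.encode φ) = ⟨ones φ.length, body (φ.map encodingClause.encode), [], [], false, 0, 0, []⟩ := by
    simp [TokSt.init, encodingCNF_encode]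
  rw [clauseCount, tokState, hd, Nat.add_comm, Function.iterate_add_apply, hinit, iterate_step_cnf,
    Function.iterate_fixed (step_exhausted _ _ _ _)]
  simp

/-- The string tokens of a CNF are the tokens of the CNF with variables renamed into binary.
[folklore] -/
theorem tokensStr_eq (φ : CNF ℕ) : tokensStr φ = tokens (φ.map fun c => c.map strLit) := rfl

end ValidCodes

end CNFIsing

end Literature.Barriers.HubbardSuperconductivity
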